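import Literature.NumberTheory.EllipticCurves.TianYuanZhang2017.GenusPeriodsParity
import Literature.NumberTheory.QuadraticFields.RedeiMatrixFourRank
import Literature.NumberTheory.EllipticCurves.TwoDescentLinearConditions
import Literature.NumberTheory.EllipticCurves.TwoDescentLocalTwoCN
import HarnessLib

/-!
# The `φ̂`-descent bound for Tian–Yuan–Zhang's `ρ(n)` through Faulkner–James' graph `G(−n)`

HONEST FRAMING (cell `b2b-bsdres`, sub-lane `bsd-p2`, Monsky sub-cell; item §R of p2-lead GEN 3, "the
D-CN-6 link"): an ELEMENTARY DESCENT INEQUALITY, PROVED in the kernel — no named fact, no `Prop`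
placeholder, nothing asserted beyond what is proved; `ρ(n)` itself is computed for no `n` here (per-`n`
certificates are the typer's instances of the door `rhoIndex_eq_one_of_card_ker`). Not a BSD statement;
nothing booked; no mark moved.

## What is proved

For `n = p₀⋯p_{t−1}`, a product of `t ≥ 1` distinct primes with `n ≡ ±1 (mod 8)`, and
`E_n : y² = x³ − n²x` (`congruentNumberCurve n`):

* `rhoIndex_pos_and_four_mul_le_card_ker` —
  `0 < [E_n(ℚ) : φ_n(A_n(ℚ)) + E_n[2]]` and
  `4 · [E_n(ℚ) : φ_n(A_n(ℚ)) + E_n[2]] ≤ #NS(L(G(−n)))`,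
  where `φ_n(A_n(ℚ)) + E_n[2]` is the tree's `TianYuanZhang2017.rhoSubgroup n` (its index is `2^{ρ(n)}`,
  Tian–Yuan–Zhang, Asian J. Math. 21 (2017), §1) and `L(G(−n))` is the Laplace matrix over `𝔽₂` of
  Faulkner–James' directed graph `G(−n)` (`fjLaplacianNeg`, COMPUTABLE, p2-monsky-eng's definition kept
  verbatim), whose null vectors are the even partitions of `G(−n)`;
* `rhoIndex_eq_one_of_card_ker` — the DOOR: `#NS(L(G(−n))) = 4` (decided per `n` by `decide`) gives
  `[E_n(ℚ) : φ_n(A_n(ℚ)) + E_n[2]] = 1`, i.e. `ρ(n) = 0` ("V1" of `p2/monsky/RHO-CERT-NOTE.md`);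
* `rhoIndex_eq_one_of_prime` — the case `t = 1` needs no certificate: `ρ(q) = 0` for EVERY prime
  `q ≡ ±1 (mod 8)` (`4 · index ≤ #NS ≤ #𝔽₂² = 4`).

## The printed results behind it (read on the held texts; locators are preprint page:line)

* Faulkner–James, Ramanujan J. 14 (2007) 107–129 [FaulknerJames2007]: "`n` will represent a positive
  square free integer greater than one" (p. 1 L11); `S′_n = {d ∈ ⟨−1, 2, p₁, …, p_s⟩ : C′_d(ℚ_p) ≠ ∅ ∀ p ∣ 2n,
  C′_d(ℚ_∞) ≠ ∅}`, `C′_d : dw² = t⁴ − (n/d)²z⁴` (p. 1 L15–L21, "[6, Ch. 10 §4]" = Silverman X.4);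
  Definition 1.5 (p. 3 L15–L33): for `n = p₁⋯p_t q₁⋯q_l ≡ ±1 (mod 8)`, `pᵢ ≡ 1 (mod 4)`, `qⱼ ≡ 3 (mod 4)`,
  `V(G(−n)) = {−1, p₁, …, p_t, q₁, …, q_l}`, arcs `pᵢ → pⱼ` iff `(pⱼ/pᵢ) = −1`, `pᵢ → qⱼ` iff `(qⱼ/pᵢ) = −1`,
  `−1 → r` iff `r ≡ ±3 (mod 8)` (arcs leave only the `pᵢ ≡ 1 (mod 4)`, so every printed symbol is
  symmetric); Definition 1.2 (p. 2 L17–L19): `(V₁, V₂)` is EVEN iff every vertex has an even number of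
  arcs into the other class; **Theorem 1.2** (p. 3 L57–L63): "Let `n` be a positive square free integer
  greater than one. … (2) If `n ≡ ±1 (mod 8)`, then `|S′_n| = #{(V₁, V₂) ⊢_e G(−n)}`"; Lemma 2.2
  (= Feng–Xiong, J. Number Theory 2004, Lemma 3.2; p. 4 L23–L49): the local conditions — (1) `p ∣ d`:
  `C′_d(ℚ_p) ≠ ∅ ⟺ (−1/p) = −1 or ((n/d)/p) = 1`; (2) `p ∣ n/d`: `⟺ (−1/p) = −1 or (d/p) = 1`; (3) `d` odd:
  `C′_d(ℚ₂) ≠ ∅ ⟺ d ≡ ±1 (mod 8) or n/d ≡ ±1 (mod 8)`; (4) `d` even `⟹ C′_d(ℚ₂) = ∅`; Definition 5.2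
  and Lemma 5.1 (= Feng–Xiong Lemma 2.2; p. 13 L40–L49): `L(G) = diag(d₁, …, d_s) − A(G)`, "the number
  of even partitions of `V(G)` is `2^{s−R}`, `R = rank_{𝔽₂} L(G)`", and (p. 14 L23) "`(V₁, V₂) ⊢_e V(G)`
  if and only if `v(V₁) ∈ NS(L(G))`".
* Silverman, AEC (2nd ed.) Prop. X.4.9 [SilvermanAEC2009]: `E(ℚ)/φ̂(E′(ℚ)) ↪ S^{(φ̂)}(E′/ℚ)`, the
  `φ̂`-Selmer group of the `2`-isogeny with kernel `(0, 0)`, realised on `d ∈ ℚ^×/ℚ^{×2}` by the quartics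
  `C′_d`; Prop. X.1.4 (the complete `2`-descent, tree `TwoDescent.lean`).
* Tian–Yuan–Zhang 2017 §1 (arXiv:1411.4728 chunk p0002 L101–L110) [TianYuanZhang2017]:
  `2^{ρ(n)} = [E_n(ℚ) : φ_n(A_n(ℚ)) + E_n[2]]`, `φ_n : A_n → E_n` the `2`-isogeny from
  `A_n : 2nv² = u³ + u` (tree `isogenyImageTYZ`, `rhoSubgroup`).

So in print: `2^{ρ(n)} = #α(E_n(ℚ))/4 ≤ |S′_n|/4 = #NS(L(G(−n)))/4`. (That `ker L` counts exactly `S′_n`,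
i.e. that the bound is Faulkner–James' `ŝ(n)`, is THEIR Theorem 1.2 (2); it is not needed for, and not
asserted by, the inequality proved here — only the containment "local conditions ⟹ null vector".)

## How it is proved here (no Selmer group, no Mordell–Weil)

Everything is a statement about RATIONAL points, in the currency of the tree's complete-`2`-descent files
(`TwoDescent.lean`, `TwoDescentLocalOdd/Two/I0.lean`, `TwoDescentLinearConditions.lean`,
`KramerTwoDescentSquares.lean`):

1. `α := x (mod ℚ^{×2})` on `E_n(ℚ)` (`(0,0) ↦ −n² ≡ −1`, `O ↦ 1`) is the tree's `twoDescentComponent`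
   for the root `e₁ = 0` — a homomorphism (`alphaHom`); `γ(P) := (sign α(P); v_{pⱼ}(α(P)) mod 2) ∈ 𝔽₂^{1+t}`
   (`coordVec`).
2. LOCAL CONDITIONS ⟹ `γ(P) ∈ NS(L(G(−n)))` (`fjLaplacianNeg_mulVec_coordVec`): the row of a prime
   `pₐ ≡ 1 (mod 4)` is the type-`I₀*` condition `qrBit pₐ (α P) = parityBit pₐ (α P) · qrBit pₐ n`
   (tree `local_condition_I0`, `(−1/pₐ) = 1`) made linear by the square-free kernel of the Legendre symbol
   (tree `qrBit_eq_signBit_add_sum`) and Euler's criterion (`kroneckerBit_eq_qrBit`); the row of `−1` is the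
   `2`-adic condition `χ₈(α(P)) = 0` — NEW here: `chi8_eq_zero_or_eq_of_point`, "`χ₈(x) = 0` or `χ₈(x) = χ₈(n)`
   on `y² = x³ − n²x`, `n` odd", by the case analysis on `v₂(x)` with residues mod `8` (tree `res8`) — made
   linear by the square-free kernel of `χ₈` (`chi8_eq_sum`); rows of primes `≡ 3 (mod 4)` are zero; even
   valuation off the `pᵢ` is the tree's `even_padicValRat_descentRep`.
3. `ker γ ⊆ φ_n(A_n(ℚ)) ∪ {O}` (`mem_rhoSubgroup_of_coordVec_eq_zero`): `γ(P) = 0 ⟹ α(P) = 1`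
   (tree `twoDescentComponent_eq_one`) `⟹ x(P) = w²`, and then EXPLICITLY `P = φ_n(u, v)` with
   `u = (w³ + y)/(nw)`, `v = wu/n`, `(u, v) ∈ A_n(ℚ)` (`some_mem_isogenyImageTYZ_of_sq`).
4. COUNT (`rhoIndex_pos_and_four_mul_le_card_ker`): `U := γ(E_n[2]) = {0, (1;0…0), (0;1…1), (1;1…1)}`
   has `4` elements (`t ≥ 1`), `γ⁻¹(U) ⊆ φ_n(A_n(ℚ)) + E_n[2]`, so
   `[E_n(ℚ) : rhoSubgroup n] ∣ [E_n(ℚ) : γ⁻¹(U)] = #γ(E_n(ℚ))/4 ≤ #NS(L)/4` (Mathlib `index_comap`,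
   `relIndex_mul_relIndex`). Finiteness comes from the finite target `𝔽₂^{1+t}`, not from Mordell–Weil.

The hypothesis `0 < t` is NECESSARY (Faulkner–James' "greater than one"): for `n = 1`, `E_1(ℚ) = E_1[2]`
gives index `1` while `NS(L(G(−1))) = 𝔽₂` has `2 < 4` elements. In the door the hypothesis
`#NS = 4` already forces `t ≥ 1`, so the door has exactly the signature of p2-monsky-eng's pilot
(`p2/monsky/eng/lean/gen3/PilotRho.lean`) minus its placeholder binder `hFJ`.

Evidence (not used in the proofs): p2-monsky-eng / p2-monsky-x / p2-lit-1 computed `ŝ(n)` three ways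
(linear algebra, literal local solubility, brute force over `d`) with `0` disagreements on `1 823 773`
square-free `n < 3·10⁶`, and checked `ρ ≤ ŝ` against published generators on `46 + 297` rank-one twists
(`p2/monsky/RHO-CERT-NOTE.md` §E/§X/§T).

## References

* [FaulknerJames2007] B. Faulkner, K. James, *A graphical approach to computing Selmer groups of congruent
  number curves*, Ramanujan J. 14 (2007) 107–129, doi:10.1007/s11139-006-9008-2 — held
  (`paper:doi-10-1007-s11139-006-9008-2`, preprint pagination): p. 1 L11–L21, Def. 1.2/1.5, Thm. 1.2,
  Lemma 2.2, Def. 5.2, Lemma 5.1, p. 14 L23.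
* [SilvermanAEC2009] J. H. Silverman, *The Arithmetic of Elliptic Curves*, 2nd ed., GTM 106, Prop. X.1.4,
  Prop. X.4.9.
* [TianYuanZhang2017] Y. Tian, X. Yuan, S.-W. Zhang, Asian J. Math. 21 (2017) 721–774 = arXiv:1411.4728,
  §1 (definition of `ρ(n)`).
* [IrelandRosen1990] K. Ireland, M. Rosen, GTM 84, Ch. 5 §1 Prop. 5.1.2 (Euler's criterion).
* K. Feng, M. Xiong, *On elliptic curves `y² = x³ − n²x` with rank zero*, J. Number Theory 109 (2004) 1–26
  (Lemmas 2.2, 3.2 as restated by Faulkner–James; not cited by key).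

## Design

Namespace `Literature.NumberTheory.EllipticCurves.FaulknerJames2007`; `fjArcNeg` / `fjLaplacianNeg` are
computable (`decide` / `decide +kernel` evaluate the null-space count for `t ≤ 6` in seconds); everything
else is `noncomputable` bookkeeping over `ℚ`. The `2`-torsion of `E_n` is taken in the order `0, −n, n`
(`hsplit = (splitTwoTorsion_cn n).swap₁₂`) so that the first descent component is `x − 0`. This file does
not import `Literature/Barriers`.
-/

noncomputable section

open scoped Classical

namespace Literature.NumberTheory.EllipticCurves.FaulknerJames2007

open Matrix
open Literature.NumberTheory.EllipticCurves.KramerTwoDescent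
open Literature.NumberTheory.EllipticCurves.TwoDescentLocal

/-! ### `χ₈` of integers and of products -/

/-- `chi8` of an odd integer is read off its class mod `8`. [folklore] -/
private theorem chi8_intCast {z : ℤ} (hz : ¬ (2 : ℤ) ∣ z) : chi8 (z : ℚ) = chi8Of (z : ZMod (2 ^ 3)) := by
  rw [chi8, res8_intCast hz]

/-- `chi8 1 = 0`. [folklore] -/
private theorem chi8_one : chi8 1 = 0 := by
  have h := chi8_mul_self 1
  rwa [mul_one] at h

/-- `chi8 (-1) = 0` (`-1 ≡ 7 (mod 8)`). [folklore] -/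
private theorem chi8_neg_one : chi8 (-1) = 0 := by
  rw [show (-1 : ℚ) = ((-1 : ℤ) : ℚ) by norm_num, chi8_intCast (by decide)]
  decide

/-- `chi8 (a²) = 0`. [folklore] -/
private theorem chi8_sq (a : ℚ) : chi8 (a ^ 2) = 0 := by rw [sq, chi8_mul_self]

/-- Powers of `2` do not change `chi8`. [folklore] -/
private theorem chi8_two_zpow_mul (k : ℤ) (a : ℚ) : chi8 ((2 : ℚ) ^ k * a) = chi8 a := by
  by_cases ha : a = 0
  · rw [ha, mul_zero]
  rw [chi8, chi8, res8_two_zpow_mul k ha]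

/-- `chi8` only depends on the odd part. [folklore] -/
private theorem chi8_unitPart (a : ℚ) : chi8 (unitPart 2 a) = chi8 a := by
  haveI : Fact (Nat.Prime 2) := ⟨Nat.prime_two⟩
  by_cases ha : a = 0
  · simp [ha, unitPart]
  conv_rhs => rw [← zpow_mul_unitPart 2 a, show ((2 : ℕ) : ℚ) = 2 from rfl]
  rw [chi8_two_zpow_mul]

/-- `chi8` of an odd natural number `m`: `1` iff `m ≡ ±3 (mod 8)`. [folklore] -/
private theorem chi8_natCast_of_odd {m : ℕ} (hm : m % 2 = 1) :
    chi8 (m : ℚ) = if m % 8 = 3 ∨ m % 8 = 5 then 1 else 0 := by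
  have hz : ¬ (2 : ℤ) ∣ (m : ℤ) := by omega
  rw [show (m : ℚ) = ((m : ℤ) : ℚ) by push_cast; rfl, chi8_intCast hz, chi8Of]
  have hcast : ((m : ℤ) : ZMod (2 ^ 3)) = (((m % 8 : ℕ) : ℤ) : ZMod (2 ^ 3)) := by
    rw [show (2 : ℕ) ^ 3 = 8 from rfl, Int.cast_natCast, Int.cast_natCast, ZMod.natCast_mod]
  rw [hcast]
  have h8 : m % 8 < 8 := Nat.mod_lt _ (by norm_num)
  interval_cases hr : m % 8 <;> simp_all <;> decide

/-- `chi8` of a product of non-zero naturals. [folklore] -/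
private theorem chi8_prod_natCast {ι : Type*} (S : Finset ι) (f : ι → ℕ) (hS : ∀ i ∈ S, f i ≠ 0) :
    chi8 (∏ i ∈ S, (f i : ℚ)) = ∑ i ∈ S, chi8 (f i : ℚ) := by
  classical
  induction S using Finset.induction_on with
  | empty => simp [chi8_one]
  | insert a S ha ih =>
    have hS' : ∀ i ∈ S, f i ≠ 0 := fun i hi => hS i (Finset.mem_insert_of_mem hi)
    have ha0 : (f a : ℚ) ≠ 0 := Nat.cast_ne_zero.mpr (hS a (Finset.mem_insert_self a S))
    have hprod : (∏ i ∈ S, (f i : ℚ)) ≠ 0 :=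
      Finset.prod_ne_zero_iff.mpr fun i hi => Nat.cast_ne_zero.mpr (hS' i hi)
    rw [Finset.prod_insert ha, Finset.sum_insert ha, chi8_mul ha0 hprod, ih hS']

/-- Positive case of the square-free kernel formula for `chi8`. [folklore] -/
private theorem chi8_eq_sum_of_pos {w : ℚ} (hw : 0 < w) (T : Finset ℕ)
    (hT : ∀ q ∈ T, q.Prime) (heven : ∀ q : ℕ, q.Prime → q ∉ T → Even (padicValRat q w)) :
    chi8 w = ∑ q ∈ T, parityBit q w * chi8 (q : ℚ) := by
  classical
  set S := T.filter fun q => ¬ Even (padicValRat q w) with hSdef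
  have hS : ∀ q ∈ S, q.Prime := fun q hq => hT q (Finset.mem_filter.mp hq).1
  have hkey : ∀ q : ℕ, q.Prime → (Even (padicValRat q w) ↔ q ∉ S) := by
    intro q hq
    rw [hSdef, Finset.mem_filter, not_and, not_not]
    constructor
    · exact fun he _ => he
    · intro himp
      by_cases hqT : q ∈ T
      · exact himp hqT
      · exact heven q hq hqT
  obtain ⟨t, ht⟩ := exists_eq_prod_mul_sq hS hw hkey
  have hprod : (∏ q ∈ S, (q : ℚ)) ≠ 0 :=
    Finset.prod_ne_zero_iff.mpr fun q hq => Nat.cast_ne_zero.mpr (hS q hq).ne_zero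
  have ht0 : t ≠ 0 := by
    rintro rfl
    rw [zero_pow two_ne_zero, mul_zero] at ht
    exact hw.ne' ht
  rw [ht, chi8_mul hprod (pow_ne_zero 2 ht0), chi8_sq, add_zero,
    chi8_prod_natCast S (fun q => q) fun q hq => (hS q hq).ne_zero, ← ht]
  have hSsub : S ⊆ T := Finset.filter_subset _ _
  rw [← Finset.sum_subset hSsub (f := fun q => parityBit q w * chi8 (q : ℚ)) ?_]
  · refine Finset.sum_congr rfl fun q hq => ?_
    have hodd : ¬ Even (padicValRat q w) := (Finset.mem_filter.mp hq).2
    rw [parityBit_eq_one_of_odd (Int.not_even_iff_odd.mp hodd), one_mul]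
  · intro q hqT hqS
    have heven' : Even (padicValRat q w) := (hkey q (hT q hqT)).mpr hqS
    rw [parityBit_eq_zero_of_even heven', zero_mul]

/-- **The square-free kernel formula for `χ₈`**: if the non-zero rational `r` has even valuation at
every odd prime outside the finite set of primes `T ∌ 2`, then `chi8 r = Σ_{q ∈ T} (v_q(r) mod 2) · chi8 q`
(the sign and the power of `2` do not matter: `χ₈(−1) = 0`). [folklore] -/
private theorem chi8_eq_sum {r : ℚ} (hr : r ≠ 0) (T : Finset ℕ) (hT : ∀ q ∈ T, q.Prime)
    (h2T : 2 ∉ T) (heven : ∀ q : ℕ, q.Prime → q ∉ T → q ≠ 2 → Even (padicValRat q r)) :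
    chi8 r = ∑ q ∈ T, parityBit q r * chi8 (q : ℚ) := by
  haveI : Fact (Nat.Prime 2) := ⟨Nat.prime_two⟩
  set u := unitPart 2 r with hu
  have hu0 : u ≠ 0 := unitPart_ne_zero 2 hr
  have hur : chi8 r = chi8 u := (chi8_unitPart r).symm
  have hpar : ∀ q ∈ T, parityBit q r = parityBit q u := by
    intro q hq
    haveI : Fact q.Prime := ⟨hT q hq⟩
    have hq2 : q ≠ 2 := fun h => h2T (h ▸ hq)
    rw [parityBit, parityBit, hu, padicValRat_unitPart_of_ne hq2]
  have hevenu : ∀ q : ℕ, q.Prime → q ∉ T → Even (padicValRat q u) := by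
    intro q hq hqT
    haveI : Fact q.Prime := ⟨hq⟩
    by_cases hq2 : q = 2
    · rw [hq2, hu, padicValRat_unitPart 2 hr]; exact ⟨0, rfl⟩
    · rw [hu, padicValRat_unitPart_of_ne hq2]; exact heven q hq hqT hq2
  rw [hur, Finset.sum_congr rfl fun q hq => by rw [hpar q hq]]
  rcases lt_or_gt_of_ne hu0 with hneg | hpos
  · have hw : 0 < -u := neg_pos.mpr hneg
    have key := chi8_eq_sum_of_pos hw T hT fun q hq hqT => by
      rw [padicValRat.neg]; exact hevenu q hq hqT
    rw [show u = -1 * (-u) by ring, chi8_mul (by norm_num) hw.ne', key, chi8_neg_one, zero_add]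
    refine Finset.sum_congr rfl fun q _ => ?_
    rw [parityBit, parityBit, show -1 * -u = u by ring, padicValRat.neg]
  · exact chi8_eq_sum_of_pos hpos T hT hevenu

/-! ### Residues and valuations: equal residues mod `2^k` of `2`-adic units -/

/-- **Congruent unit parts.** If two non-zero rationals of `2`-adic valuation `0` have the same residue
modulo `2^k`, their difference is `0` or has valuation `≥ k`. [folklore] -/
private theorem le_padicValRat_sub_of_resPow_eq {k : ℕ} {a b : ℚ} (ha : padicValRat 2 a = 0)
    (hb : padicValRat 2 b = 0) (h : resPow 2 k a = resPow 2 k b) :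
    a - b = 0 ∨ (k : ℤ) ≤ padicValRat 2 (a - b) := by
  haveI : Fact (Nat.Prime 2) := ⟨Nat.prime_two⟩
  by_cases hab : a - b = 0
  · exact Or.inl hab
  right
  -- the difference of the two `2`-adic integers lies in the kernel of `toZModPow k`
  have hua : unitPart 2 a = a := unitPart_of_eq_zero 2 ha
  have hub : unitPart 2 b = b := unitPart_of_eq_zero 2 hb
  have hker : unitPartInt 2 a - unitPartInt 2 b ∈ RingHom.ker (PadicInt.toZModPow (p := 2) k) := by
    rw [RingHom.mem_ker, map_sub, sub_eq_zero]
    exact h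
  rw [PadicInt.ker_toZModPow, ← PadicInt.norm_le_pow_iff_mem_span_pow] at hker
  have hcoe : ((unitPartInt 2 a - unitPartInt 2 b : ℤ_[2]) : ℚ_[2]) = (((a - b : ℚ)) : ℚ_[2]) := by
    rw [PadicInt.coe_sub]
    simp only [unitPartInt, hua, hub, Rat.cast_sub]
  have hnorm : ‖(((a - b : ℚ)) : ℚ_[2])‖ ≤ (2 : ℝ) ^ (-(k : ℤ)) := by
    rw [← hcoe, ← PadicInt.norm_def]; exact_mod_cast hker
  rw [Padic.eq_padicNorm, padicNorm.eq_zpow_of_nonzero hab] at hnorm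
  have h' : (2 : ℝ) ^ (-padicValRat 2 (a - b)) ≤ (2 : ℝ) ^ (-(k : ℤ)) := by
    have : (((2 : ℚ) ^ (-padicValRat 2 (a - b)) : ℚ) : ℝ) = (2 : ℝ) ^ (-padicValRat 2 (a - b)) := by
      push_cast; rfl
    rw [← this]; exact_mod_cast hnorm
  have := (zpow_le_zpow_iff_right₀ (by norm_num : (1 : ℝ) < 2)).mp h'
  omega

/-! ### The `2`-adic condition on `y² = x³ − n²x`, `n` odd -/

/-- Finite checks on `ℤ/8` behind the three cases. [folklore] -/
private theorem zmod8_odd_aux :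
    (∀ r s e : ZMod (2 ^ 3), r * r = 1 → s * s = 1 →
      r * (r + 4 * (e * s)) * (r + 4 * (e * (((-1 : ℤ) : ZMod (2 ^ 3)) * s))) = 1 → chi8Of r = 0) ∧
    (∀ s e : ZMod (2 ^ 3), s * s = 1 →
      chi8Of (((-1 : ℤ) : ZMod (2 ^ 3)) * s + 2 * (s + 4 * e)) = chi8Of s) ∧
    (∀ s e : ZMod (2 ^ 3), s * s = 1 →
      chi8Of (s + 2 * (((-1 : ℤ) : ZMod (2 ^ 3)) * s + 4 * e)) = chi8Of s) ∧
    (∀ r s e : ZMod (2 ^ 3), r * r = 1 → s * s = 1 →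
      r * (s + 4 * e) * (((-1 : ℤ) : ZMod (2 ^ 3)) * s + 4 * e) = 1 → chi8Of r = 0) := by
  refine ⟨by decide, by decide, by decide, by decide⟩

/-- **The `2`-adic condition of the `x`-coordinate descent on `E_n : y² = x (x + n)(x − n)`, `n` odd**:
for every rational point `(x, y)` with `y ≠ 0`, the odd part of `x` is `≡ ±1 (mod 8)` or
`≡ ±n (mod 8)`, i.e. `χ₈(x) = 0` or `χ₈(x) = χ₈(n)` — the condition "`d ≡ ±1 (mod 8)` or
`n/d ≡ ±1 (mod 8)`" for the square class `d` of `x` (Faulkner–James Lemma 2.2 (3), after Feng–Xiong),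
here for RATIONAL points by the elementary case analysis on `v₂(x)`: `v₂(x) < 0`: the three factors
have the valuation of `x` and residues `r, r ± 4e`, so `r = 1`; `v₂(x) ≥ 1`: then `v₂(x)` is even `≥ 2`,
`res8 (x ± n) = ±s + 4e` and the product formula gives `r = 7`; `v₂(x) = 0`: `v₂(x² − n²) = 2 v₂(y) ≥ 4`,
one of `x ± n` has valuation exactly `1` and the other `≥ 3`, whence `r = ∓ s`.
[cite: FaulknerJames2007, Lemma 2.2 (3)] -/
theorem chi8_eq_zero_or_eq_of_point {n : ℤ} (hn : Odd n) {x y : ℚ}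
    (h : y ^ 2 = (x - 0) * (x - -(n : ℚ)) * (x - n)) (hy : y ≠ 0) :
    chi8 x = 0 ∨ chi8 x = chi8 (n : ℚ) := by
  haveI : Fact (Nat.Prime 2) := ⟨Nat.prime_two⟩
  obtain ⟨hd₂, hd₁, hd₃⟩ := sub_ne_zero_of_sq_eq h hy
  rw [sub_zero] at hd₂ h
  have hn2 : ¬ (2 : ℤ) ∣ n := by rcases hn with ⟨k, rfl⟩; omega
  have hn0 : (n : ℚ) ≠ 0 := by exact_mod_cast (show n ≠ 0 by rintro rfl; exact hn2 ⟨0, rfl⟩)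
  have hvn : padicValRat 2 (n : ℚ) = 0 := padicValRat_intCast_eq_zero (by exact_mod_cast hn2)
  have hvnn : padicValRat 2 (-(n : ℚ)) = 0 := by rw [padicValRat.neg, hvn]
  have h2n0 : (2 : ℚ) * n ≠ 0 := mul_ne_zero two_ne_zero hn0
  have hv2n : padicValRat 2 ((2 : ℚ) * n) = 1 := by
    rw [padicValRat.mul two_ne_zero hn0, hvn, show (2 : ℚ) = ((2 : ℕ) : ℚ) from rfl,
      padicValRat.self one_lt_two]; rfl
  have hv2nn : padicValRat 2 (-((2 : ℚ) * n)) = 1 := by rw [padicValRat.neg, hv2n]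
  -- residues of the constants
  set s := res8 (n : ℚ) with hs
  have hss : s * s = 1 := res8_mul_self hn0
  have hrnn : res8 (-(n : ℚ)) = ((-1 : ℤ) : ZMod (2 ^ 3)) * s := by
    rw [show -(n : ℚ) = ((-1 : ℤ) : ℚ) * n by push_cast; ring, res8_mul (by norm_num) hn0,
      res8_intCast (by decide)]
  have hr2n : res8 ((2 : ℚ) * n) = s := by
    rw [show (2 : ℚ) * n = (2 : ℚ) ^ (1 : ℤ) * n by ring, res8_two_zpow_mul 1 hn0]
  have hr2nn : res8 (-((2 : ℚ) * n)) = ((-1 : ℤ) : ZMod (2 ^ 3)) * s := by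
    rw [show -((2 : ℚ) * n) = (2 : ℚ) ^ (1 : ℤ) * (-(n : ℚ)) by ring,
      res8_two_zpow_mul 1 (neg_ne_zero.mpr hn0), hrnn]
  have hcn : chi8 (n : ℚ) = chi8Of s := rfl
  -- the product relation
  set r := res8 x with hr
  have hrr : r * r = 1 := res8_mul_self hd₂
  have hprod : r * res8 (x - -n) * res8 (x - n) = 1 := by
    have h1 : res8 (y ^ 2) = r * res8 (x - -n) * res8 (x - n) := by
      rw [h, res8_mul (mul_ne_zero hd₂ hd₁) hd₃, res8_mul hd₂ hd₁]
    rw [← h1, res8_sq, sq, res8_mul_self hy]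
  have hsum := even_sum_padicValRat_of_sq (p := 2) h hd₂ hd₁ hd₃
  obtain ⟨aux_A, aux_B1, aux_B2, aux_C⟩ := zmod8_odd_aux
  have hx₁ : x - -(n : ℚ) = x + n := by ring
  have hx₃ : x - (n : ℚ) = x + -n := by ring
  set v := padicValRat 2 x with hv
  rcases lt_trichotomy v 0 with hneg | hzero | hpos
  · -- Case `v₂(x) < 0`: all three factors have valuation `v`, which is even, `≤ -2`
    left
    have hv₁ : padicValRat 2 (x - -n) = v := by
      rw [hx₁]; exact (padicValRat_add_eq_left hd₂ (Or.inr (by rw [hvn]; omega))).2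
    have hv₃ : padicValRat 2 (x - n) = v := by
      rw [hx₃]; exact (padicValRat_add_eq_left hd₂ (Or.inr (by rw [hvnn]; omega))).2
    rw [hv₁, hv₃] at hsum
    have heven : Even v := by obtain ⟨k, hk⟩ := hsum; exact ⟨k - v, by omega⟩
    obtain ⟨k, hk⟩ := Int.eq_ofNat_of_zero_le (show (0 : ℤ) ≤ -v by omega)
    have hk2 : 2 ≤ k := by obtain ⟨j, hj⟩ := heven; omega
    have hk0 : (0 : ℤ) = v + k := by omega
    have hr₁ : res8 (x - -n) = r + 4 * (2 ^ (k - 2) * s) := by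
      rw [hx₁, res8_add_of_eq hd₂ (k := k) (by omega) (by rw [hvn]; exact hk0),
        two_pow_eq_four_mul hk2, mul_assoc]
    have hr₃ : res8 (x - n) = r + 4 * (2 ^ (k - 2) * (((-1 : ℤ) : ZMod (2 ^ 3)) * s)) := by
      rw [hx₃, res8_add_of_eq hd₂ (k := k) (by omega) (by rw [hvnn]; exact hk0), hrnn,
        two_pow_eq_four_mul hk2, mul_assoc]
    rw [hr₁, hr₃] at hprod
    exact aux_A r s _ hrr hss hprod
  · -- Case `v₂(x) = 0`
    right
    -- `v₂(x² - n²) ≥ 3` from the residues, hence `= 2 v₂(y) ≥ 4`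
    have hx2v : padicValRat 2 (x ^ 2) = 0 := by rw [padicValRat.pow, ← hv, hzero, mul_zero]
    have hn2v : padicValRat 2 ((n : ℚ) ^ 2) = 0 := by rw [padicValRat.pow, hvn, mul_zero]
    have hres : resPow 2 3 (x ^ 2) = resPow 2 3 ((n : ℚ) ^ 2) := by
      show res8 (x ^ 2) = res8 ((n : ℚ) ^ 2)
      rw [res8_sq, res8_sq, sq, sq, ← hr, hrr, hss]
    have hfac : x ^ 2 - (n : ℚ) ^ 2 = (x - -n) * (x - n) := by ring
    have hne : x ^ 2 - (n : ℚ) ^ 2 ≠ 0 := by rw [hfac]; exact mul_ne_zero hd₁ hd₃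
    have h3 : (3 : ℤ) ≤ padicValRat 2 (x - -n) + padicValRat 2 (x - n) := by
      rcases le_padicValRat_sub_of_resPow_eq hx2v hn2v hres with h0 | h3
      · exact absurd h0 hne
      · rw [hfac, padicValRat.mul hd₁ hd₃] at h3; exact_mod_cast h3
    have hvy : 2 * padicValRat 2 y = padicValRat 2 (x - -n) + padicValRat 2 (x - n) := by
      have := congrArg (padicValRat 2) h
      rw [padicValRat.pow, padicValRat.mul (mul_ne_zero hd₂ hd₁) hd₃, padicValRat.mul hd₂ hd₁,
        ← hv, hzero, zero_add] at this
      exact_mod_cast this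
    have h4 : (4 : ℤ) ≤ padicValRat 2 (x - -n) + padicValRat 2 (x - n) := by omega
    -- both valuations are `≥ 0`, not both `≥ 2` (their difference `2n` has valuation `1`)
    have hge₁ : (0 : ℤ) ≤ padicValRat 2 (x - -n) := by
      rw [hx₁]
      exact (le_padicValRat_add_or (p := 2) (c := 0) (Or.inr (by rw [← hv, hzero]))
        (Or.inr (by rw [hvn]))).resolve_left (by rw [← hx₁]; exact hd₁)
    have hge₃ : (0 : ℤ) ≤ padicValRat 2 (x - n) := by
      rw [hx₃]
      exact (le_padicValRat_add_or (p := 2) (c := 0) (Or.inr (by rw [← hv, hzero]))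
        (Or.inr (by rw [hvnn]))).resolve_left (by rw [← hx₃]; exact hd₃)
    have hnot : ¬ ((2 : ℤ) ≤ padicValRat 2 (x - -n) ∧ (2 : ℤ) ≤ padicValRat 2 (x - n)) := by
      rintro ⟨ha, hb⟩
      have key := le_padicValRat_add_or (p := 2) (c := 2) (a := x - -n) (b := -(x - n)) (Or.inr ha)
        (Or.inr (by rw [padicValRat.neg]; exact hb))
      have h2n : x - -(n : ℚ) + -(x - n) = 2 * n := by ring
      rw [h2n, hv2n] at key
      rcases key with h0 | h2
      · exact h2n0 h0
      · omega
    by_cases hcase : padicValRat 2 (x - -n) ≤ 1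
    · -- `v(x + n) = 1`, `v(x - n) = m ≥ 3`
      have hb3 : (3 : ℤ) ≤ padicValRat 2 (x - n) := by omega
      have ha1 : padicValRat 2 (x - -n) = 1 := by
        rcases (show padicValRat 2 (x - -n) = 0 ∨ padicValRat 2 (x - -n) = 1 by omega) with h0 | h1
        · -- then `x - n = (x + n) - 2n` would have valuation `0`
          exfalso
          have := (padicValRat_add_eq_left (p := 2) hd₁ (b := -((2 : ℚ) * n))
            (Or.inr (by rw [hv2nn, h0]; norm_num))).2
          rw [show x - -(n : ℚ) + -((2 : ℚ) * n) = x - n by ring, h0] at this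
          omega
        · exact h1
      -- `x = -n + (x + n)`
      obtain ⟨m, hm, hm3⟩ : ∃ m : ℕ, padicValRat 2 (x - n) = padicValRat 2 ((2 : ℚ) * n) + m ∧ 2 ≤ m :=
        ⟨(padicValRat 2 (x - n) - 1).toNat, by rw [hv2n]; omega, by omega⟩
      have hra : res8 (x - -n) = s + 4 * (2 ^ (m - 2) * res8 (x - n)) := by
        have : x - -(n : ℚ) = 2 * n + (x - n) := by ring
        rw [this, res8_add_of_eq h2n0 (k := m) (by omega) hm, hr2n, two_pow_eq_four_mul hm3, mul_assoc]
      have hrx : r = ((-1 : ℤ) : ZMod (2 ^ 3)) * s + 2 * (s + 4 * (2 ^ (m - 2) * res8 (x - n))) := by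
        have hxe : res8 x = res8 (-n + (x - -n)) := by congr 1; ring
        rw [hr, hxe, res8_add_of_eq (neg_ne_zero.mpr hn0) (k := 1) le_rfl (by rw [hvnn, ha1]; rfl),
          hrnn, pow_one, hra]
      rw [chi8, ← hr, hrx, aux_B1 s _ hss, hcn]
    · -- `v(x - n) = 1`, `v(x + n) = m ≥ 3`
      have ha2 : (2 : ℤ) ≤ padicValRat 2 (x - -n) := by omega
      have hb1' : padicValRat 2 (x - n) ≤ 1 := by
        by_contra hcon; exact hnot ⟨ha2, by omega⟩
      have hb1 : padicValRat 2 (x - n) = 1 := by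
        rcases (show padicValRat 2 (x - n) = 0 ∨ padicValRat 2 (x - n) = 1 by omega) with h0 | h1
        · exfalso
          have := (padicValRat_add_eq_left (p := 2) hd₃ (b := (2 : ℚ) * n)
            (Or.inr (by rw [hv2n, h0]; norm_num))).2
          rw [show x - (n : ℚ) + (2 : ℚ) * n = x - -n by ring, h0] at this
          omega
        · exact h1
      have ha3 : (3 : ℤ) ≤ padicValRat 2 (x - -n) := by omega
      obtain ⟨m, hm, hm3⟩ : ∃ m : ℕ, padicValRat 2 (x - -n) = padicValRat 2 (-((2 : ℚ) * n)) + m ∧ 2 ≤ m :=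
        ⟨(padicValRat 2 (x - -n) - 1).toNat, by rw [hv2nn]; omega, by omega⟩
      have hrb : res8 (x - n) = ((-1 : ℤ) : ZMod (2 ^ 3)) * s + 4 * (2 ^ (m - 2) * res8 (x - -n)) := by
        have : x - (n : ℚ) = -((2 : ℚ) * n) + (x - -n) := by ring
        rw [this, res8_add_of_eq (neg_ne_zero.mpr h2n0) (k := m) (by omega) hm, hr2nn,
          two_pow_eq_four_mul hm3, mul_assoc]
      have hrx : r = s + 2 * (((-1 : ℤ) : ZMod (2 ^ 3)) * s + 4 * (2 ^ (m - 2) * res8 (x - -n))) := by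
        have hxe : res8 x = res8 (n + (x - n)) := by congr 1; ring
        rw [hr, hxe, res8_add_of_eq hn0 (k := 1) le_rfl (by rw [hvn, hb1]; rfl), ← hs, pow_one, hrb]
      rw [chi8, ← hr, hrx, aux_B2 s _ hss, hcn]
  · -- Case `v₂(x) ≥ 1`: then `v₂(x ± n) = 0`, `v₂(x)` is even `≥ 2`
    left
    have hv₁ : padicValRat 2 (x - -n) = 0 := by
      rw [hx₁, add_comm, ← hvn]
      exact (padicValRat_add_eq_left hn0 (Or.inr (by rw [hvn]; omega))).2
    have hv₃ : padicValRat 2 (x - n) = 0 := by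
      rw [hx₃, add_comm, ← hvnn]
      exact (padicValRat_add_eq_left (neg_ne_zero.mpr hn0) (Or.inr (by rw [hvnn]; omega))).2
    rw [hv₁, hv₃] at hsum
    have heven : Even v := by obtain ⟨k, hk⟩ := hsum; exact ⟨k, by omega⟩
    obtain ⟨k, hk, hk2⟩ : ∃ k : ℕ, v = (0 : ℤ) + k ∧ 2 ≤ k :=
      ⟨v.toNat, by omega, by obtain ⟨j, hj⟩ := heven; omega⟩
    have hr₁ : res8 (x - -n) = s + 4 * (2 ^ (k - 2) * r) := by
      rw [hx₁, add_comm, res8_add_of_eq hn0 (k := k) (by omega) (by rw [hvn, ← hv]; exact hk),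
        two_pow_eq_four_mul hk2, mul_assoc]
    have hr₃ : res8 (x - n) = ((-1 : ℤ) : ZMod (2 ^ 3)) * s + 4 * (2 ^ (k - 2) * r) := by
      rw [hx₃, add_comm, res8_add_of_eq (neg_ne_zero.mpr hn0) (k := k) (by omega)
        (by rw [hvnn, ← hv]; exact hk), hrnn, two_pow_eq_four_mul hk2, mul_assoc]
    rw [hr₁, hr₃] at hprod
    exact aux_C r s _ hrr hss hprod


/-! ## The directed graph `G(−n)` of Faulkner–James and its Laplacian over `𝔽₂` (computable) -/

section Graph

variable {t : ℕ}

open Literature.NumberTheory.QuadraticFields.RedeiReichardt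

/-- Arc indicator of Faulkner–James' directed graph `G(−n)` (`n = p₀⋯p_{t−1}` odd square-free) on the
vertices `0 ↦ −1`, `k.succ ↦ p k`: from a prime `p a ≡ 1 (mod 4)` to `p b` iff `(p b / p a) = −1`
(Euler's criterion through the computable `RedeiReichardt.kroneckerBit`; for `p a ≡ 1 (mod 4)` this
symbol is symmetric, as printed); from `−1` to `p b` iff `p b ≡ ±3 (mod 8)`; no arcs out of primes
`≡ 3 (mod 4)`, none into `−1`, no loops (definition of p2-monsky-eng, kept verbatim so that its
`decide` certificates apply). [cite: FaulknerJames2007, Def. 1.5 (the graph G(−n))] -/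
def fjArcNeg (p : Fin t → ℕ) (i j : Fin (t + 1)) : ZMod 2 :=
  if i = j then 0 else
    Fin.cases (motive := fun _ => ZMod 2)
      (Fin.cases (motive := fun _ => ZMod 2) 0 (fun b => if p b % 8 = 3 ∨ p b % 8 = 5 then 1 else 0) j)
      (fun a => if p a % 4 = 1 then Fin.cases (motive := fun _ => ZMod 2) 0 (fun b => kroneckerBit (p b) (p a)) j else 0)
      i

/-- The Laplace matrix `L(G(−n)) = diag(out-degrees) − A(G(−n))` over `𝔽₂` (off-diagonal entry = arc
indicator, diagonal entry = out-degree parity). Its null vectors are exactly the indicator functions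
`v(V₁)` of the EVEN PARTITIONS `(V₁, V₂)` of `G(−n)` (Feng–Xiong Lemma 2.2 = Faulkner–James Lemma 5.1
and the sentence "(V₁, V₂) ⊢_e V(G) if and only if v(V₁) ∈ NS(L(G))").
[cite: FaulknerJames2007, Def. 5.2 (Laplace matrix) and Lemma 5.1; §5, proof of Lemma 5.2 (p. 14 of the preprint)] -/
def fjLaplacianNeg (p : Fin t → ℕ) : Matrix (Fin (t + 1)) (Fin (t + 1)) (ZMod 2) :=
  Matrix.of fun i j => if i = j then ∑ l ∈ Finset.univ.erase i, fjArcNeg p i l else fjArcNeg p i j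

variable (p : Fin t → ℕ)

/-- No loops. [cite: FaulknerJames2007, Def. 1.5] -/
theorem fjArcNeg_self (i : Fin (t + 1)) : fjArcNeg p i i = 0 := by
  simp [fjArcNeg]

/-- No arcs into the vertex `−1`. [cite: FaulknerJames2007, Def. 1.5] -/
theorem fjArcNeg_zero_right (i : Fin (t + 1)) : fjArcNeg p i 0 = 0 := by
  unfold fjArcNeg
  split_ifs with h
  · rfl
  · refine Fin.cases ?_ (fun a => ?_) i
    · rfl
    · simp only [Fin.cases_succ, Fin.cases_zero]
      split_ifs <;> rfl

/-- The arcs out of `−1`: to the primes `≡ ±3 (mod 8)`. [cite: FaulknerJames2007, Def. 1.5] -/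
theorem fjArcNeg_zero_succ (b : Fin t) :
    fjArcNeg p 0 b.succ = if p b % 8 = 3 ∨ p b % 8 = 5 then 1 else 0 := by
  simp [fjArcNeg, (Fin.succ_ne_zero b).symm]

/-- The arcs between primes: out of `p a ≡ 1 (mod 4)` to `p b` iff `(p b / p a) = −1`.
[cite: FaulknerJames2007, Def. 1.5] -/
theorem fjArcNeg_succ_succ (a b : Fin t) :
    fjArcNeg p a.succ b.succ = if a = b then 0 else if p a % 4 = 1 then kroneckerBit (p b) (p a) else 0 := by
  by_cases hab : a = b
  · subst hab; simp [fjArcNeg]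
  · simp [fjArcNeg, hab, Fin.succ_inj]

/-- No arcs out of a prime `≢ 1 (mod 4)`. [cite: FaulknerJames2007, Def. 1.5] -/
theorem fjArcNeg_succ_of_ne (a : Fin t) (ha : p a % 4 ≠ 1) (j : Fin (t + 1)) : fjArcNeg p a.succ j = 0 := by
  unfold fjArcNeg
  split_ifs with h
  · rfl
  · simp [ha]

/-- **The Laplacian applied to a vector**: `(L x)_i = Σ_l arc(i → l) (x_i + x_l)` — the parity of the
number of arcs out of `i` crossing the partition `{x = 0} ⊔ {x = 1}`.
[cite: FaulknerJames2007, §5, proof of Lemma 5.2] -/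
theorem fjLaplacianNeg_mulVec (x : Fin (t + 1) → ZMod 2) (i : Fin (t + 1)) :
    (fjLaplacianNeg p *ᵥ x) i = ∑ l, fjArcNeg p i l * (x i + x l) := by
  classical
  rw [Matrix.mulVec, dotProduct]
  simp only [fjLaplacianNeg, Matrix.of_apply]
  rw [← Finset.add_sum_erase Finset.univ _ (Finset.mem_univ i), if_pos rfl,
    ← Finset.add_sum_erase Finset.univ (fun l => fjArcNeg p i l * (x i + x l)) (Finset.mem_univ i),
    fjArcNeg_self, zero_mul, zero_add, Finset.sum_mul, ← Finset.sum_add_distrib]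
  refine Finset.sum_congr rfl fun j hj => ?_
  rw [if_neg (Finset.ne_of_mem_erase hj).symm, mul_add]

/-- **Sufficient conditions for a null vector** (`x = (x₋₁; ξ)`): the row of `−1` reads
`Σ_b [p b ≡ ±3 (8)] (x₋₁ + ξ_b) = 0`, the row of a prime `p a ≡ 1 (mod 4)` reads
`Σ_{b ≠ a} [(p b / p a) = −1] (ξ_a + ξ_b) = 0`, and the rows of the primes `≡ 3 (mod 4)` are zero.
[cite: FaulknerJames2007, §5, proof of Lemma 5.2] -/
theorem fjLaplacianNeg_mulVec_eq_zero (x : Fin (t + 1) → ZMod 2)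
    (h0 : ∑ b : Fin t, (if p b % 8 = 3 ∨ p b % 8 = 5 then (1 : ZMod 2) else 0) * (x 0 + x b.succ) = 0)
    (h1 : ∀ a : Fin t, p a % 4 = 1 →
      ∑ b ∈ Finset.univ.erase a, kroneckerBit (p b) (p a) * (x a.succ + x b.succ) = 0) :
    fjLaplacianNeg p *ᵥ x = 0 := by
  classical
  funext i
  rw [fjLaplacianNeg_mulVec, Pi.zero_apply, Fin.sum_univ_succ, fjArcNeg_zero_right, zero_mul, zero_add]
  refine Fin.cases ?_ (fun a => ?_) i
  · simpa only [fjArcNeg_zero_succ] using h0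
  · by_cases ha : p a % 4 = 1
    · rw [← Finset.add_sum_erase Finset.univ (fun b => fjArcNeg p a.succ b.succ * (x a.succ + x b.succ))
        (Finset.mem_univ a), fjArcNeg_self, zero_mul, zero_add, ← h1 a ha]
      refine Finset.sum_congr rfl fun b hb => ?_
      rw [fjArcNeg_succ_succ, if_neg (Finset.ne_of_mem_erase hb).symm, if_pos ha]
    · simp [fjArcNeg_succ_of_ne p a ha]

end Graph

/-! ## The `x`-coordinate descent on `E_n`, `n = p₀⋯p_{t−1}` -/

section Descent

open WeierstrassCurve WeierstrassCurve.Affine WeierstrassCurve.Affine.Point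
open Literature.NumberTheory.EllipticCurves.TianYuanZhang2017
open Literature.NumberTheory.QuadraticFields.RedeiReichardt

variable {t : ℕ} (p : Fin t → ℕ)

/-! ### Arithmetic of `n = ∏ pᵢ` -/

/-- A product of primes is non-zero. [folklore] -/
private theorem prod_ne_zero_of_prime (hp : ∀ i, (p i).Prime) : (∏ i, p i) ≠ 0 :=
  Finset.prod_ne_zero_iff.mpr fun i _ => (hp i).ne_zero

/-- The valuations of `n = ∏ pᵢ` (distinct primes): `1` at the `pᵢ`, `0` elsewhere. [folklore] -/
private theorem padicValRat_prod (hp : ∀ i, (p i).Prime) (hinj : Function.Injective p) (q : ℕ) [Fact q.Prime] :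
    padicValRat q (((∏ i, p i : ℕ) : ℚ)) = if q ∈ Finset.univ.image p then 1 else 0 := by
  classical
  rw [Nat.cast_prod, ← Finset.prod_image (s := Finset.univ) (g := p) (f := fun q : ℕ => (q : ℚ))
    (fun i _ j _ h => hinj h)]
  exact padicValRat_prod_primes (fun q hq => by
    obtain ⟨i, -, rfl⟩ := Finset.mem_image.mp hq; exact hp i) q

/-- `v_{pᵢ}(n) = 1`. [folklore] -/
private theorem padicValRat_prod_self (hp : ∀ i, (p i).Prime) (hinj : Function.Injective p) (i : Fin t) :
    haveI : Fact (p i).Prime := ⟨hp i⟩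
    padicValRat (p i) (((∏ i, p i : ℕ) : ℚ)) = 1 := by
  classical
  haveI : Fact (p i).Prime := ⟨hp i⟩
  rw [padicValRat_prod p hp hinj, if_pos (Finset.mem_image_of_mem p (Finset.mem_univ i))]

/-- `v_q(n) = 0` at a prime `q` not among the `pᵢ`. [folklore] -/
private theorem padicValRat_prod_of_notMem (hp : ∀ i, (p i).Prime) (hinj : Function.Injective p) {q : ℕ}
    (hq : q.Prime) (hqp : q ∉ Finset.univ.image p) : padicValRat q (((∏ i, p i : ℕ) : ℚ)) = 0 := by
  classical
  haveI : Fact q.Prime := ⟨hq⟩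
  rw [padicValRat_prod p hp hinj, if_neg hqp]

/-- If `n = ∏ pᵢ ≡ ±1 (mod 8)` then every `pᵢ` is odd. [folklore] -/
private theorem prime_ne_two (hp : ∀ i, (p i).Prime) (h8 : (∏ i, p i) % 8 = 1 ∨ (∏ i, p i) % 8 = 7) (i : Fin t) :
    p i ≠ 2 := by
  intro h2
  have hdvd : 2 ∣ ∏ i, p i := h2 ▸ Finset.dvd_prod_of_mem p (Finset.mem_univ i)
  have := hp i
  omega

/-- … and `2` is not among the `pᵢ`. [folklore] -/
private theorem two_notMem_image (hp : ∀ i, (p i).Prime) (h8 : (∏ i, p i) % 8 = 1 ∨ (∏ i, p i) % 8 = 7) :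
    2 ∉ Finset.univ.image p := by
  classical
  intro h
  obtain ⟨i, -, hi⟩ := Finset.mem_image.mp h
  exact prime_ne_two p hp h8 i hi

/-- `χ₈(n) = 0` for `n ≡ ±1 (mod 8)`, and `χ₈(n) = Σᵢ χ₈(pᵢ)`. [folklore] -/
private theorem sum_chi8_eq_zero (hp : ∀ i, (p i).Prime) (h8 : (∏ i, p i) % 8 = 1 ∨ (∏ i, p i) % 8 = 7) :
    ∑ i, (if p i % 8 = 3 ∨ p i % 8 = 5 then (1 : ZMod 2) else 0) = 0 := by
  have hodd : ∀ i, p i % 2 = 1 := fun i => (hp i).eq_two_or_odd.resolve_left (prime_ne_two p hp h8 i)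
  have key : chi8 (((∏ i, p i : ℕ) : ℚ)) = ∑ i, chi8 (p i : ℚ) := by
    rw [Nat.cast_prod]; exact chi8_prod_natCast Finset.univ p fun i _ => (hp i).ne_zero
  have hn : chi8 (((∏ i, p i : ℕ) : ℚ)) = 0 := by
    have hodd' : (∏ i, p i) % 2 = 1 := by omega
    rw [chi8_natCast_of_odd hodd', if_neg (by omega)]
  rw [← Finset.sum_congr rfl fun i _ => chi8_natCast_of_odd (hodd i), ← key, hn]

/-! ### The descent map `α = x (mod ℚ^{×2})` and its coordinates -/

/-- `E_n` has the rational `2`-torsion `0, −n, n` (in this order: `T₁ = (0, 0)`). [folklore] -/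
private theorem hsplit (n : ℕ) : (congruentNumberCurve n).toAffine.SplitTwoTorsion 0 (-(n : ℚ)) n :=
  (splitTwoTorsion_cn n).swap₁₂

/-- **The `x`-coordinate descent** `α : E_n(ℚ) → ℚ^×/ℚ^{×2}`, `(x, y) ↦ x`, `(0, 0) ↦ −n² ≡ −1`, `O ↦ 1`:
the first component of the complete `2`-descent for the root `e₁ = 0` (Silverman AEC Prop. X.1.4; tree
`twoDescentComponent`), i.e. the connecting map of the `2`-isogeny with kernel `(0, 0)` whose kernel is
`φ̂(E′_n(ℚ)) = φ_n(A_n(ℚ))` (Silverman AEC X.4.9). As an additive homomorphism. [cite: SilvermanAEC2009, Prop. X.1.4] -/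
def alphaHom (n : ℕ) (hn : n ≠ 0) : (congruentNumberCurve n).toAffine.Point →+ Additive (SqUnits ℚ) where
  toFun P := Additive.ofMul (twoDescentComponent (congruentNumberCurve n).toAffine 0 (-(n : ℚ)) n P)
  map_zero' := rfl
  map_add' P Q := by
    haveI := isElliptic_congruentNumberCurve hn
    rw [twoDescentComponent_add (hsplit n)]; rfl

/-- `α(P)` is the class of the rational representative `descentRep 0 (−n) n P`. [folklore] -/
private theorem alphaHom_apply (n : ℕ) (hn : n ≠ 0) (P : (congruentNumberCurve n).toAffine.Point) :
    alphaHom n hn P = Additive.ofMul (sqClass (descentRep 0 (-(n : ℚ)) n P)) := by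
  show Additive.ofMul (twoDescentComponent _ 0 (-(n : ℚ)) n P) = _
  rw [twoDescentComponent_eq_sqClass]

/-- **The coordinate vector** `γ(P) = (sign of α(P); v_{pⱼ}(α(P)) mod 2)_j ∈ 𝔽₂^{1+t}` — the candidate
even partition of `G(−n)` attached to a rational point (`−1 ∈ V₁` iff `α(P) < 0`, `pⱼ ∈ V₁` iff
`pⱼ ∣ d`, `d` the square class of `x(P)`). [cite: FaulknerJames2007, §4, Lemmas 4.3–4.4 (the correspondence d ↔ (V₁, V₂))] -/
def coordVec (hp : ∀ i, (p i).Prime) :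
    (congruentNumberCurve (∏ i, p i)).toAffine.Point →+ (Fin (t + 1) → ZMod 2) :=
  AddMonoidHom.pi fun i => Fin.cases (motive := fun _ => _ →+ ZMod 2)
    (signHom.comp (alphaHom _ (prod_ne_zero_of_prime p hp)))
    (fun j => (@parityHom (p j) ⟨hp j⟩).comp (alphaHom _ (prod_ne_zero_of_prime p hp))) i

/-- The `−1`-coordinate of `γ(P)` is the sign bit of `α(P)`. [folklore] -/
private theorem coordVec_apply_zero (hp : ∀ i, (p i).Prime) (P : (congruentNumberCurve (∏ i, p i)).toAffine.Point) :
    coordVec p hp P 0 = signBit (descentRep 0 (-((∏ i, p i : ℕ) : ℚ)) (∏ i, p i : ℕ) P) := by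
  haveI := isElliptic_congruentNumberCurve (prod_ne_zero_of_prime p hp)
  simp only [coordVec, AddMonoidHom.pi_apply, Fin.cases_zero, AddMonoidHom.coe_comp, Function.comp_apply,
    alphaHom_apply]
  exact signHom_sqClass (descentRep_ne_zero (hsplit _) P)

/-- The `pⱼ`-coordinate of `γ(P)` is `v_{pⱼ}(α(P)) mod 2`. [folklore] -/
private theorem coordVec_apply_succ (hp : ∀ i, (p i).Prime) (P : (congruentNumberCurve (∏ i, p i)).toAffine.Point)
    (j : Fin t) :
    coordVec p hp P j.succ = parityBit (p j) (descentRep 0 (-((∏ i, p i : ℕ) : ℚ)) (∏ i, p i : ℕ) P) := by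
  haveI := isElliptic_congruentNumberCurve (prod_ne_zero_of_prime p hp)
  haveI : Fact (p j).Prime := ⟨hp j⟩
  simp only [coordVec, AddMonoidHom.pi_apply, Fin.cases_succ, AddMonoidHom.coe_comp, Function.comp_apply,
    alphaHom_apply]
  exact parityHom_sqClass (descentRep_ne_zero (hsplit _) P)

/-- **The representative of `α(P)`, case by case**: `1` at `O`, `−n²` at `(0,0)`, `∓n` at `(∓n, 0)`, and
`x` at a point `(x, y)` with `y ≠ 0`, `y² = x (x + n)(x − n)`. [cite: SilvermanAEC2009, Prop. X.1.4] -/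
theorem descentRep_cases {n : ℕ} (hn : n ≠ 0) (P : (congruentNumberCurve n).toAffine.Point) :
    descentRep 0 (-(n : ℚ)) n P = 1 ∨ descentRep 0 (-(n : ℚ)) n P = -(n : ℚ) ^ 2 ∨
      descentRep 0 (-(n : ℚ)) n P = -(n : ℚ) ∨ descentRep 0 (-(n : ℚ)) n P = n ∨
      ∃ x y : ℚ, y ≠ 0 ∧ y ^ 2 = (x - 0) * (x - -(n : ℚ)) * (x - n) ∧ descentRep 0 (-(n : ℚ)) n P = x := by
  haveI := isElliptic_congruentNumberCurve hn
  have hn0 : (n : ℚ) ≠ 0 := Nat.cast_ne_zero.mpr hn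
  rcases point_cases (hsplit n) P with rfl | rfl | rfl | rfl | ⟨x, y, hP, rfl, hx₁, hx₂, hx₃, hy, hsq⟩
  · exact Or.inl descentRep_zero
  · right; left; rw [descentRep_some_of_eq _ rfl]; ring
  · right; right; left; rw [descentRep_some_of_ne _ (neg_ne_zero.mpr hn0), sub_zero]
  · right; right; right; left; rw [descentRep_some_of_ne _ hn0, sub_zero]
  · right; right; right; right
    simp only [cn_affine_a₁, cn_affine_a₃, zero_mul, add_zero, zero_div] at hy hsq
    exact ⟨x, y, hy, hsq, by rw [descentRep_some_of_ne _ hx₁, sub_zero]⟩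

/-! ### The local conditions -/

/-- **At `2`**: `χ₈(α(P)) = 0` for every rational point when `n ≡ ±1 (mod 8)` (`n` odd square-free) — the
condition "`d ≡ ±1 (mod 8)` or `n/d ≡ ±1 (mod 8)`" of Faulkner–James Lemma 2.2 (3).
[cite: FaulknerJames2007, Lemma 2.2 (3)] -/
theorem chi8_descentRep (hp : ∀ i, (p i).Prime) (h8 : (∏ i, p i) % 8 = 1 ∨ (∏ i, p i) % 8 = 7)
    (P : (congruentNumberCurve (∏ i, p i)).toAffine.Point) :
    chi8 (descentRep 0 (-((∏ i, p i : ℕ) : ℚ)) (∏ i, p i : ℕ) P) = 0 := by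
  have hn := prod_ne_zero_of_prime p hp
  have hn0 : ((∏ i, p i : ℕ) : ℚ) ≠ 0 := Nat.cast_ne_zero.mpr hn
  have hodd : (∏ i, p i) % 2 = 1 := by omega
  have hchi : chi8 (((∏ i, p i : ℕ) : ℚ)) = 0 := by rw [chi8_natCast_of_odd hodd, if_neg (by omega)]
  rcases descentRep_cases hn P with h | h | h | h | ⟨x, y, hy, hsq, h⟩ <;> rw [h]
  · exact chi8_one
  · rw [show -((∏ i, p i : ℕ) : ℚ) ^ 2 = -1 * (((∏ i, p i : ℕ) : ℚ) * ((∏ i, p i : ℕ) : ℚ)) by ring,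
      chi8_mul (by norm_num) (mul_ne_zero hn0 hn0), chi8_neg_one, chi8_mul_self, add_zero]
  · rw [show -((∏ i, p i : ℕ) : ℚ) = -1 * ((∏ i, p i : ℕ) : ℚ) by ring, chi8_mul (by norm_num) hn0,
      chi8_neg_one, hchi, add_zero]
  · exact hchi
  · have hoddZ : Odd ((∏ i, p i : ℕ) : ℤ) := by exact_mod_cast Nat.odd_iff.mpr hodd
    rcases chi8_eq_zero_or_eq_of_point hoddZ (by exact_mod_cast hsq) hy with h0 | h1
    · exact h0
    · rw [h1]; exact_mod_cast hchi

/-- **At a prime `pₐ ≡ 1 (mod 4)` dividing `n`** (type `I₀*`): the `pₐ`-adic class of `α(P)` is `1` or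
`n`, i.e. `qrBit pₐ (α P) = parityBit pₐ (α P) · qrBit pₐ n` — Faulkner–James Lemma 2.2 (1)–(2) with
`(−1/pₐ) = 1`, for rational points by the tree's `local_condition_I0`.
[cite: FaulknerJames2007, Lemma 2.2 (1)–(2)] [cite: SilvermanAEC2009, Prop. X.1.4] -/
theorem qrBit_descentRep (hp : ∀ i, (p i).Prime) (hinj : Function.Injective p)
    (h8 : (∏ i, p i) % 8 = 1 ∨ (∏ i, p i) % 8 = 7) (a : Fin t) (ha : p a % 4 = 1)
    (P : (congruentNumberCurve (∏ i, p i)).toAffine.Point) :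
    haveI : Fact (p a).Prime := ⟨hp a⟩
    qrBit (p a) (descentRep 0 (-((∏ i, p i : ℕ) : ℚ)) (∏ i, p i : ℕ) P) =
      parityBit (p a) (descentRep 0 (-((∏ i, p i : ℕ) : ℚ)) (∏ i, p i : ℕ) P) *
        qrBit (p a) (((∏ i, p i : ℕ) : ℚ)) := by
  haveI : Fact (p a).Prime := ⟨hp a⟩
  have hn := prod_ne_zero_of_prime p hp
  set N : ℚ := ((∏ i, p i : ℕ) : ℚ) with hN
  have hn0 : N ≠ 0 := Nat.cast_ne_zero.mpr hn
  have hvN : padicValRat (p a) N = 1 := padicValRat_prod_self p hp hinj a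
  have hpa2 : p a ≠ 2 := prime_ne_two p hp h8 a
  -- `(−1 / pₐ) = 1`
  have hm1 : qrBit (p a) (-1 : ℚ) = 0 := by
    rw [show (-1 : ℚ) = ((-1 : ℤ) : ℚ) by norm_num]
    refine qrBit_intCast_of_jacobiSym_eq_one ?_
    rw [jacobiSym.at_neg_one ((hp a).eq_two_or_odd'.resolve_left hpa2), ZMod.χ₄_nat_one_mod_four ha]
  have hqN2 : qrBit (p a) (-N ^ 2) = 0 := by
    rw [show -N ^ 2 = -1 * N ^ 2 by ring, qrBit_mul (p a) (by norm_num) (pow_ne_zero 2 hn0), hm1,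
      qrBit_sq, add_zero]
  have hqnN : qrBit (p a) (-N) = qrBit (p a) N := by
    rw [qrBit_neg hn0, hm1, zero_add]
  have hpar1 : parityBit (p a) (1 : ℚ) = 0 := parityBit_eq_zero_of_even (by rw [padicValRat.one]; exact ⟨0, rfl⟩)
  have hparN : parityBit (p a) N = 1 := parityBit_eq_one_of_odd (by rw [hvN]; exact odd_one)
  have hparnN : parityBit (p a) (-N) = 1 := parityBit_eq_one_of_odd (by rw [padicValRat.neg, hvN]; exact odd_one)
  have hparN2 : parityBit (p a) (-N ^ 2) = 0 :=
    parityBit_eq_zero_of_even (by rw [padicValRat.neg, padicValRat.pow, hvN]; exact ⟨1, rfl⟩)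
  rcases descentRep_cases hn P with h | h | h | h | ⟨x, y, hy, hsq, h⟩ <;> rw [h]
  · rw [qrBit_one, hpar1, zero_mul]
  · rw [hqN2, hparN2, zero_mul]
  · rw [hqnN, hparnN, one_mul]
  · rw [hparN, one_mul]
  · -- generic point: type `I₀*` at `pₐ`
    have h12 : padicValRat (p a) ((0 : ℚ) - -N) = 1 := by rw [sub_neg_eq_add, zero_add, hvN]
    have h13 : padicValRat (p a) ((0 : ℚ) - N) = 1 := by rw [zero_sub, padicValRat.neg, hvN]
    have h23 : padicValRat (p a) (-N - N) = 1 := by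
      have hv2 : padicValRat (p a) ((-2 : ℤ) : ℚ) = 0 := by
        refine padicValRat_intCast_eq_zero ?_
        rw [show (-2 : ℤ) = -((2 : ℕ) : ℤ) by norm_num, Int.dvd_neg, Int.natCast_dvd_natCast,
          Nat.prime_dvd_prime_iff_eq (hp a) Nat.prime_two]
        exact hpa2
      rw [show -N - N = ((-2 : ℤ) : ℚ) * N by push_cast; ring, padicValRat.mul (by norm_num) hn0, hvN, hv2,
        zero_add]
    have key := local_condition_I0 (p := p a) hsq hy h12 h13 h23
    rw [sub_zero] at key
    rcases key with ⟨h1, h2, -, -⟩ | ⟨h1, h2, -, -⟩ | ⟨h1, h2, -, -⟩ | ⟨h1, h2, -, -⟩ <;> rw [h1, h2]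
    · rw [zero_mul]
    · rw [show ((0 : ℚ) - -N) * (0 - N) = -N ^ 2 by ring, hqN2, zero_mul]
    · rw [sub_zero, hqnN, one_mul]
    · rw [sub_zero, one_mul]

end Descent

section Kernel

open WeierstrassCurve WeierstrassCurve.Affine WeierstrassCurve.Affine.Point
open Literature.NumberTheory.EllipticCurves.TianYuanZhang2017
open Literature.NumberTheory.QuadraticFields.RedeiReichardt

variable {t : ℕ} (p : Fin t → ℕ)

/-! ### From the local conditions to the null space of `L(G(−n))` -/

/-- `qrBit` of a product of non-zero naturals (indexed form). [folklore] -/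
private theorem qrBit_prod_natCast' {q : ℕ} [Fact q.Prime] {ι : Type*} (S : Finset ι) (f : ι → ℕ)
    (hS : ∀ i ∈ S, f i ≠ 0) : qrBit q (∏ i ∈ S, (f i : ℚ)) = ∑ i ∈ S, qrBit q (f i : ℚ) := by
  classical
  induction S using Finset.induction_on with
  | empty => simp [qrBit_one]
  | insert a S ha ih =>
    have hS' : ∀ i ∈ S, f i ≠ 0 := fun i hi => hS i (Finset.mem_insert_of_mem hi)
    have ha0 : (f a : ℚ) ≠ 0 := Nat.cast_ne_zero.mpr (hS a (Finset.mem_insert_self a S))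
    have hprod : (∏ i ∈ S, (f i : ℚ)) ≠ 0 :=
      Finset.prod_ne_zero_iff.mpr fun i hi => Nat.cast_ne_zero.mpr (hS' i hi)
    rw [Finset.prod_insert ha, Finset.sum_insert ha, qrBit_mul q ha0 hprod, ih hS']

/-- **Euler's criterion bridge**: for distinct odd primes `ℓ ≠ q`, the computable bit `kroneckerBit ℓ q`
(`[(ℓ/q) = −1]`) is the residue bit `qrBit q ℓ` of the tree's `2`-descent files.
[cite: IrelandRosen1990, Ch. 5 §1 Prop. 5.1.2 (Euler's criterion)] -/
theorem kroneckerBit_eq_qrBit {q ℓ : ℕ} (hq : q.Prime) (hq2 : q ≠ 2) (hℓ : ℓ.Prime) (hne : ℓ ≠ q) :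
    haveI : Fact q.Prime := ⟨hq⟩
    kroneckerBit ℓ q = qrBit q (ℓ : ℚ) := by
  haveI : Fact q.Prime := ⟨hq⟩
  have hnd : ¬ (q : ℤ) ∣ (ℓ : ℤ) := by
    rw [Int.natCast_dvd_natCast, Nat.prime_dvd_prime_iff_eq hq hℓ]; exact fun h => hne h.symm
  have hne0 : ((ℓ : ℤ) : ZMod q) ≠ 0 := by
    rwa [Ne, ZMod.intCast_zmod_eq_zero_iff_dvd]
  have hq' : qrBit q (ℓ : ℚ) = if legendreSym q ℓ = -1 then 1 else 0 := by
    rw [show (ℓ : ℚ) = ((ℓ : ℤ) : ℚ) by norm_cast]; exact qrBit_intCast hnd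
  have hk := kroneckerBit_eq_one_iff_jacobiSym (a := ℓ) hq hq2 hne0
  rw [← jacobiSym.legendreSym.to_jacobiSym] at hk
  rw [hq']
  by_cases h : legendreSym q ℓ = -1
  · rw [if_pos h]; exact hk.mpr h
  · rw [if_neg h]
    have h2 : ∀ z : ZMod 2, z ≠ 1 → z = 0 := by decide
    exact h2 _ fun h1 => h (hk.mp h1)

/-- Off the primes `pᵢ` the representative of `α(P)` has even valuation (including at `2` and at the
real place nothing is required). [cite: SilvermanAEC2009, Prop. X.1.4] -/
theorem even_padicValRat_descentRep_of_notMem (hp : ∀ i, (p i).Prime) (hinj : Function.Injective p)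
    (P : (congruentNumberCurve (∏ i, p i)).toAffine.Point) {q : ℕ} (hq : q.Prime)
    (hqp : q ∉ Finset.univ.image p) :
    Even (padicValRat q (descentRep 0 (-((∏ i, p i : ℕ) : ℚ)) (∏ i, p i : ℕ) P)) := by
  haveI := isElliptic_congruentNumberCurve (prod_ne_zero_of_prime p hp)
  haveI : Fact q.Prime := ⟨hq⟩
  have hv := padicValRat_prod_of_notMem p hp hinj hq hqp
  exact even_padicValRat_descentRep (hsplit _) P (by rw [sub_neg_eq_add, zero_add, hv])
    (by rw [zero_sub, padicValRat.neg, hv])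

/-- **The coordinate vector of every rational point is a null vector of `L(G(−n))`** (`n ≡ ±1 (mod 8)`):
the row of `−1` is the `2`-adic condition `χ₈(α(P)) = 0` written through the square-free kernel of `χ₈`,
and the row of `pₐ ≡ 1 (mod 4)` is the `I₀*` condition `qrBit pₐ (α P) = parityBit pₐ (α P) · qrBit pₐ n`
written through the square-free kernel of the Legendre symbol — i.e. the square class of `x(P)` gives an
even partition of `G(−n)`. [cite: FaulknerJames2007, Lemma 4.4 and Thm. 1.2 (2)] -/
theorem fjLaplacianNeg_mulVec_coordVec (hp : ∀ i, (p i).Prime) (hinj : Function.Injective p)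
    (h8 : (∏ i, p i) % 8 = 1 ∨ (∏ i, p i) % 8 = 7) (P : (congruentNumberCurve (∏ i, p i)).toAffine.Point) :
    fjLaplacianNeg p *ᵥ (coordVec p hp P) = 0 := by
  classical
  haveI := isElliptic_congruentNumberCurve (prod_ne_zero_of_prime p hp)
  set r := descentRep 0 (-((∏ i, p i : ℕ) : ℚ)) (∏ i, p i : ℕ) P with hr
  have hr0 : r ≠ 0 := descentRep_ne_zero (hsplit _) P
  have hodd : ∀ i, p i % 2 = 1 := fun i => (hp i).eq_two_or_odd.resolve_left (prime_ne_two p hp h8 i)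
  refine fjLaplacianNeg_mulVec_eq_zero p _ ?_ fun a ha => ?_
  · -- the row of `−1`
    simp only [coordVec_apply_zero, coordVec_apply_succ, mul_add, Finset.sum_add_distrib, ← Finset.sum_mul,
      sum_chi8_eq_zero p hp h8, zero_mul, zero_add]
    have key := chi8_eq_sum hr0 (Finset.univ.image p)
      (fun q hq => by obtain ⟨i, -, rfl⟩ := Finset.mem_image.mp hq; exact hp i) (two_notMem_image p hp h8)
      (fun q hq hqp _ => even_padicValRat_descentRep_of_notMem p hp hinj P hq hqp)
    rw [Finset.sum_image fun i _ j _ h => hinj h] at key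
    rw [← hr]
    calc ∑ b, (if p b % 8 = 3 ∨ p b % 8 = 5 then (1 : ZMod 2) else 0) * parityBit (p b) r
        = ∑ b, parityBit (p b) r * chi8 (p b : ℚ) :=
          Finset.sum_congr rfl fun b _ => by rw [chi8_natCast_of_odd (hodd b), mul_comm]
      _ = chi8 r := key.symm
      _ = 0 := by rw [hr]; exact chi8_descentRep p hp h8 P
  · -- the row of `pₐ ≡ 1 (mod 4)`
    haveI : Fact (p a).Prime := ⟨hp a⟩
    have hpa2 : p a ≠ 2 := prime_ne_two p hp h8 a
    have hkb : ∀ b ∈ Finset.univ.erase a, kroneckerBit (p b) (p a) = qrBit (p a) (p b : ℚ) := fun b hb =>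
      kroneckerBit_eq_qrBit (hp a) hpa2 (hp b) fun h => Finset.ne_of_mem_erase hb (hinj h)
    rw [Finset.sum_congr rfl fun b hb => by rw [hkb b hb]]
    simp only [coordVec_apply_succ, mul_add, Finset.sum_add_distrib, ← Finset.sum_mul]
    -- `Σ_{b ≠ a} qrBit pₐ p_b = qrBit pₐ n`
    have hN : ∑ b ∈ Finset.univ.erase a, qrBit (p a) (p b : ℚ) = qrBit (p a) (((∏ i, p i : ℕ) : ℚ)) := by
      rw [← qrBit_prod_natCast' _ p fun i _ => (hp i).ne_zero, Nat.cast_prod,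
        ← Finset.mul_prod_erase Finset.univ (fun i => (p i : ℚ)) (Finset.mem_univ a), qrBit_natCast_mul]
    -- `Σ_{b ≠ a} qrBit pₐ p_b · parityBit p_b r = qrBit pₐ r` (square-free kernel, `(−1/pₐ) = 1`)
    have hm1 : qrBit (p a) (-1 : ℚ) = 0 := by
      rw [show (-1 : ℚ) = ((-1 : ℤ) : ℚ) by norm_num]
      refine qrBit_intCast_of_jacobiSym_eq_one ?_
      rw [jacobiSym.at_neg_one ((hp a).eq_two_or_odd'.resolve_left hpa2), ZMod.χ₄_nat_one_mod_four ha]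
    have key := qrBit_eq_signBit_add_sum hr0 ((Finset.univ.erase a).image p)
      (fun q hq => by obtain ⟨i, -, rfl⟩ := Finset.mem_image.mp hq; exact hp i)
      (fun h => by
        obtain ⟨i, hi, hia⟩ := Finset.mem_image.mp h
        exact Finset.ne_of_mem_erase hi (hinj hia))
      (fun q hq hqT hqa => by
        refine even_padicValRat_descentRep_of_notMem p hp hinj P hq fun hmem => ?_
        obtain ⟨i, -, rfl⟩ := Finset.mem_image.mp hmem
        by_cases hia : i = a
        · exact hqa (by rw [hia])
        · exact hqT (Finset.mem_image.mpr ⟨i, Finset.mem_erase.mpr ⟨hia, Finset.mem_univ i⟩, rfl⟩))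
    rw [hm1, mul_zero, zero_add, Finset.sum_image fun i _ j _ h => hinj h] at key
    rw [hN, Finset.sum_congr rfl fun b _ => mul_comm (qrBit (p a) (p b : ℚ)) _, ← key, ← hr,
      qrBit_descentRep p hp hinj h8 a ha P]
    have h2 : ∀ u v : ZMod 2, v * u + u * v = 0 := by decide
    exact h2 _ _

/-! ### The kernel of `α` lies in `φ_n(A_n(ℚ))` -/

/-- A point of `E_n` whose coordinates are those of `φ_n(u, v)` lies in the image set `isogenyImageTYZ n`.
[cite: TianYuanZhang2017, §1, definition of ρ(n) (p0002 L101–L110)] -/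
theorem some_mem_isogenyImageTYZ {n : ℕ} {u v x y : ℚ} (hA : 2 * n * v ^ 2 = u ^ 3 + u) (hu : u ≠ 0)
    (hP : (congruentNumberCurve n).toAffine.Nonsingular x y) (hX : x = n * ((u + u⁻¹) / 2))
    (hY : y = (n : ℚ) ^ 2 * (v / (2 * u) * (u - u⁻¹))) :
    Point.some x y hP ∈ isogenyImageTYZ n := by
  subst hX hY
  exact Or.inr ⟨u, v, hA, hu, hP, rfl⟩

/-- **The explicit section of `φ_n` over points with square `x`-coordinate**: if `(x, y) ∈ E_n(ℚ)` has
`x = w²`, `w ≠ 0`, then `(x, y) = φ_n(u, v)` with `u = (w³ + y)/(nw)`, `v = wu/n`, `(u, v) ∈ A_n(ℚ)`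
(`u⁻¹ = (w³ − y)/(nw)` since `(w³ + y)(w³ − y) = w⁶ − y² = n²w²`) — the elementary content of
"`x ∈ ℚ^{×2} ⟹ P ∈ φ̂(E′(ℚ))`" (Silverman AEC X.4.9 / Silverman–Tate III.5) for TYZ's `φ_n`.
[cite: SilvermanAEC2009, Prop. X.4.9] [cite: TianYuanZhang2017, §1, definition of ρ(n)] -/
theorem some_mem_isogenyImageTYZ_of_sq {n : ℕ} (hn : n ≠ 0) {x y w : ℚ}
    (hP : (congruentNumberCurve n).toAffine.Nonsingular x y) (hw : w ≠ 0) (hx : x = w ^ 2) :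
    Point.some x y hP ∈ isogenyImageTYZ n := by
  have hn0 : (n : ℚ) ≠ 0 := Nat.cast_ne_zero.mpr hn
  have hcurve : y ^ 2 = (x - -(n : ℚ)) * (x - 0) * (x - n) := (cn_nonsingular_iff hn x y).mp hP
  rw [hx] at hcurve
  have hwy : w ^ 3 + y ≠ 0 := by
    intro h
    have hy' : y = -w ^ 3 := by linear_combination h
    rw [hy'] at hcurve
    have key : ((n : ℚ) * w) ^ 2 = 0 := by linear_combination hcurve
    exact mul_ne_zero hn0 hw (pow_eq_zero_iff two_ne_zero |>.mp key)
  set u : ℚ := (w ^ 3 + y) / (n * w) with hu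
  have hu0 : u ≠ 0 := div_ne_zero hwy (mul_ne_zero hn0 hw)
  have hinv : u⁻¹ = (w ^ 3 - y) / (n * w) := by
    rw [hu, inv_div, div_eq_div_iff hwy (mul_ne_zero hn0 hw)]
    linear_combination hcurve
  refine some_mem_isogenyImageTYZ (u := u) (v := w * u / n) ?_ hu0 hP ?_ ?_
  · rw [hu]; field_simp; linear_combination -hcurve
  · rw [hinv, hu, hx]; field_simp; ring
  · rw [hinv]
    have : w * u / n / (2 * u) = w / (2 * n) := by field_simp
    rw [this, hu]; field_simp; ring

/-- **`ker γ ⊆ φ_n(A_n(ℚ)) + E_n[2]`**: a rational point whose descent class `α(P)` is positive with even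
valuation at every `pᵢ` has `α(P) = 1` (even valuation elsewhere is automatic), i.e. `x(P) ∈ ℚ^{×2}`, so
`P ∈ φ_n(A_n(ℚ))` (or `P = O`). [cite: SilvermanAEC2009, Prop. X.1.4 and Prop. X.4.9] -/
theorem mem_rhoSubgroup_of_coordVec_eq_zero (hp : ∀ i, (p i).Prime) (hinj : Function.Injective p)
    (P : (congruentNumberCurve (∏ i, p i)).toAffine.Point) (h0 : coordVec p hp P = 0) :
    P ∈ rhoSubgroup (∏ i, p i) := by
  classical
  have hn := prod_ne_zero_of_prime p hp
  haveI := isElliptic_congruentNumberCurve hn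
  set N : ℚ := ((∏ i, p i : ℕ) : ℚ) with hN
  have hn0 : N ≠ 0 := Nat.cast_ne_zero.mpr hn
  have hs : signBit (descentRep 0 (-N) (∏ i, p i : ℕ) P) = 0 := by
    rw [← coordVec_apply_zero p hp P, h0]; rfl
  have hpos := descentRep_pos_of_signBit (hsplit _) P hs
  have hα : twoDescentComponent _ 0 (-N) (∏ i, p i : ℕ) P = 1 := by
    refine twoDescentComponent_eq_one (hsplit _) P (Finset.univ.image p) (fun q hq hqp => ?_) hpos
      (fun q hq => ?_)
    · have hv := padicValRat_prod_of_notMem p hp hinj hq hqp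
      exact ⟨by rw [sub_neg_eq_add, zero_add, hv], by rw [zero_sub, padicValRat.neg, hv]⟩
    · obtain ⟨j, -, rfl⟩ := Finset.mem_image.mp hq
      refine parityBit_eq_zero_iff.mp ?_
      rw [← coordVec_apply_succ p hp P j, h0]; rfl
  rcases P with _ | ⟨x, y, hP⟩
  · exact AddSubgroup.zero_mem _
  · by_cases hx : x = 0
    · exfalso
      rw [descentRep_some_of_eq hP hx] at hpos
      have : (0 : ℚ) < -N ^ 2 := by linear_combination hpos
      nlinarith [sq_nonneg N]
    · rw [twoDescentComponent_some_of_ne hP hx, sqClass_eq_one_iff (sub_ne_zero.mpr hx), sub_zero] at hα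
      obtain ⟨w, hw⟩ := hα
      have hw0 : w ≠ 0 := by rintro rfl; exact hx (by rw [hw]; ring)
      exact AddSubgroup.subset_closure (Or.inl (some_mem_isogenyImageTYZ_of_sq hn hP hw0 hw))

end Kernel

section Count

open WeierstrassCurve WeierstrassCurve.Affine WeierstrassCurve.Affine.Point
open Literature.NumberTheory.EllipticCurves.TianYuanZhang2017
open Literature.NumberTheory.QuadraticFields.RedeiReichardt

variable {t : ℕ} (p : Fin t → ℕ)

/-! ### The image of the `2`-torsion -/

/-- The vectors `(ε₁; ε₂, …, ε₂) ∈ 𝔽₂^{1+t}`, as a homomorphism of `(ε₁, ε₂) ∈ 𝔽₂²`: its range `U` is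
the image under `γ` of `E_n[2]` (`γ(0,0) = (1; 0…0)`, `γ(n, 0) = (0; 1…1)`). [folklore] -/
def torsionVecHom (t : ℕ) : ZMod 2 × ZMod 2 →+ (Fin (t + 1) → ZMod 2) where
  toFun ε i := Fin.cases (motive := fun _ => ZMod 2) ε.1 (fun _ => ε.2) i
  map_zero' := by funext i; exact Fin.cases rfl (fun _ => rfl) i
  map_add' ε ε' := by funext i; exact Fin.cases rfl (fun _ => rfl) i

/-- `torsionVecHom` is injective as soon as there is at least one prime (`t ≥ 1`). [folklore] -/
private theorem torsionVecHom_injective (ht : 0 < t) : Function.Injective (torsionVecHom t) := by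
  intro ε ε' h
  have h0 := congr_fun h 0
  have h1 := congr_fun h (Fin.succ ⟨0, ht⟩)
  simp only [torsionVecHom, AddMonoidHom.coe_mk, ZeroHom.coe_mk, Fin.cases_zero, Fin.cases_succ] at h0 h1
  exact Prod.ext h0 h1

/-- `#U = 4`. [folklore] -/
private theorem natCard_range_torsionVecHom (ht : 0 < t) : Nat.card (torsionVecHom t).range = 4 := by
  rw [← Nat.card_congr (AddMonoidHom.ofInjective (torsionVecHom_injective ht)).toEquiv]
  simp [Nat.card_eq_fintype_card]

/-- `γ(0, 0) = (1; 0, …, 0)`: `α(0,0) = −n²` is negative of even valuation everywhere. [cite: SilvermanAEC2009, Prop. X.1.4] -/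
private theorem coordVec_T0 (hp : ∀ i, (p i).Prime) (hinj : Function.Injective p) :
    haveI := isElliptic_congruentNumberCurve (prod_ne_zero_of_prime p hp)
    coordVec p hp (.some 0 _ (nonsingular_twoTorsion (hsplit (∏ i, p i)))) = torsionVecHom t (1, 0) := by
  haveI := isElliptic_congruentNumberCurve (prod_ne_zero_of_prime p hp)
  have hn0 : (((∏ i, p i : ℕ)) : ℚ) ≠ 0 := Nat.cast_ne_zero.mpr (prod_ne_zero_of_prime p hp)
  have hrep : descentRep 0 (-((∏ i, p i : ℕ) : ℚ)) (∏ i, p i : ℕ)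
      (.some 0 _ (nonsingular_twoTorsion (hsplit (∏ i, p i))) : (congruentNumberCurve (∏ i, p i)).toAffine.Point) =
      -(((∏ i, p i : ℕ)) : ℚ) ^ 2 := by
    rw [descentRep_some_of_eq _ rfl]; ring
  funext i
  refine Fin.cases ?_ (fun j => ?_) i
  · rw [coordVec_apply_zero, hrep]
    rw [signBit, if_pos (by have := sq_pos_of_ne_zero hn0; linarith)]; rfl
  · haveI : Fact (p j).Prime := ⟨hp j⟩
    rw [coordVec_apply_succ, hrep]
    exact parityBit_eq_zero_of_even
      (by rw [padicValRat.neg, padicValRat.pow, padicValRat_prod_self p hp hinj j]; exact ⟨1, rfl⟩)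

/-- `γ(n, 0) = (0; 1, …, 1)`: `α(n, 0) = n`. [cite: SilvermanAEC2009, Prop. X.1.4] -/
private theorem coordVec_Tpos (hp : ∀ i, (p i).Prime) (hinj : Function.Injective p) :
    haveI := isElliptic_congruentNumberCurve (prod_ne_zero_of_prime p hp)
    coordVec p hp (.some _ _ (nonsingular_twoTorsion (hsplit (∏ i, p i)).swap₂₃.swap₁₂)) =
      torsionVecHom t (0, 1) := by
  haveI := isElliptic_congruentNumberCurve (prod_ne_zero_of_prime p hp)
  have hn0 : (((∏ i, p i : ℕ)) : ℚ) ≠ 0 := Nat.cast_ne_zero.mpr (prod_ne_zero_of_prime p hp)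
  have hrep : descentRep 0 (-((∏ i, p i : ℕ) : ℚ)) (∏ i, p i : ℕ)
      (.some _ _ (nonsingular_twoTorsion (hsplit (∏ i, p i)).swap₂₃.swap₁₂) :
        (congruentNumberCurve (∏ i, p i)).toAffine.Point) = ((∏ i, p i : ℕ) : ℚ) := by
    rw [descentRep_some_of_ne _ hn0, sub_zero]
  funext i
  refine Fin.cases ?_ (fun j => ?_) i
  · rw [coordVec_apply_zero, hrep]
    rw [signBit, if_neg (not_lt.mpr (Nat.cast_nonneg _))]; rfl
  · haveI : Fact (p j).Prime := ⟨hp j⟩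
    rw [coordVec_apply_succ, hrep]
    exact parityBit_eq_one_of_odd (by rw [padicValRat_prod_self p hp hinj j]; exact odd_one)

/-- Every element of `𝔽₂` is `0` or `1`. [folklore] -/
private theorem zmod2_cases (e : ZMod 2) : e = 0 ∨ e = 1 := by revert e; decide

/-- `(1, 1) = (1, 0) + (0, 1)` in `𝔽₂²`. [folklore] -/
private theorem one_one_eq : ((1 : ZMod 2), (1 : ZMod 2)) = (1, 0) + (0, 1) := by
  rw [Prod.mk_add_mk, add_zero, zero_add]

/-- `U ≤ γ(E_n(ℚ))`. [folklore] -/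
private theorem range_torsionVecHom_le (hp : ∀ i, (p i).Prime) (hinj : Function.Injective p) :
    (torsionVecHom t).range ≤ (coordVec p hp).range := by
  haveI := isElliptic_congruentNumberCurve (prod_ne_zero_of_prime p hp)
  rintro _ ⟨⟨e₁, e₂⟩, rfl⟩
  have hA := coordVec_T0 p hp hinj
  have hB := coordVec_Tpos p hp hinj
  rcases zmod2_cases e₁ with rfl | rfl <;> rcases zmod2_cases e₂ with rfl | rfl
  · rw [show ((0 : ZMod 2), (0 : ZMod 2)) = 0 from rfl, _root_.map_zero]; exact zero_mem _
  · exact ⟨_, hB⟩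
  · exact ⟨_, hA⟩
  · rw [one_one_eq, _root_.map_add, ← hA, ← hB, ← _root_.map_add]
    exact ⟨_, rfl⟩

/-- **`γ⁻¹(U) ≤ φ_n(A_n(ℚ)) + E_n[2]`**: a point whose coordinate vector is that of a `2`-torsion point
`T` differs from `T` by an element of `ker γ ⊆ φ_n(A_n(ℚ))`. [cite: SilvermanAEC2009, Prop. X.4.9] -/
theorem comap_le_rhoSubgroup (hp : ∀ i, (p i).Prime) (hinj : Function.Injective p) :
    ((torsionVecHom t).range).comap (coordVec p hp) ≤ rhoSubgroup (∏ i, p i) := by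
  haveI := isElliptic_congruentNumberCurve (prod_ne_zero_of_prime p hp)
  intro P hP
  obtain ⟨⟨e₁, e₂⟩, he⟩ := hP
  have hA := coordVec_T0 p hp hinj
  have hB := coordVec_Tpos p hp hinj
  -- the two torsion points lie in `rhoSubgroup`
  have hT0 : (Point.some 0 _ (nonsingular_twoTorsion (hsplit (∏ i, p i))) :
      (congruentNumberCurve (∏ i, p i)).toAffine.Point) ∈ rhoSubgroup (∏ i, p i) :=
    AddSubgroup.subset_closure (Or.inr (two_nsmul_twoTorsion (hsplit (∏ i, p i))))
  have hTp : (Point.some _ _ (nonsingular_twoTorsion (hsplit (∏ i, p i)).swap₂₃.swap₁₂) :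
      (congruentNumberCurve (∏ i, p i)).toAffine.Point) ∈ rhoSubgroup (∏ i, p i) :=
    AddSubgroup.subset_closure (Or.inr (two_nsmul_twoTorsion (hsplit (∏ i, p i)).swap₂₃.swap₁₂))
  -- reduce to the kernel
  have hker : ∀ Q T : (congruentNumberCurve (∏ i, p i)).toAffine.Point, T ∈ rhoSubgroup (∏ i, p i) →
      coordVec p hp Q = coordVec p hp T → Q ∈ rhoSubgroup (∏ i, p i) := by
    intro Q T hT hQT
    have h0 : coordVec p hp (Q - T) = 0 := by rw [_root_.map_sub, hQT, sub_self]
    have := (rhoSubgroup (∏ i, p i)).add_mem (mem_rhoSubgroup_of_coordVec_eq_zero p hp hinj (Q - T) h0) hT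
    rwa [sub_add_cancel] at this
  rcases zmod2_cases e₁ with rfl | rfl <;> rcases zmod2_cases e₂ with rfl | rfl
  · rw [show ((0 : ZMod 2), (0 : ZMod 2)) = 0 from rfl, _root_.map_zero] at he
    exact mem_rhoSubgroup_of_coordVec_eq_zero p hp hinj P he.symm
  · exact hker P _ hTp (by rw [← he, hB])
  · exact hker P _ hT0 (by rw [← he, hA])
  · refine hker P _ ((rhoSubgroup (∏ i, p i)).add_mem hT0 hTp) ?_
    rw [← he, _root_.map_add, hA, hB, ← _root_.map_add, one_one_eq]

/-! ### The bound -/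

/-- **The `φ̂`-descent bound for Tian–Yuan–Zhang's `ρ(n)` through Faulkner–James' graph `G(−n)`.**
For `n = p₀⋯p_{t−1}` a product of `t ≥ 1` distinct primes with `n ≡ ±1 (mod 8)`:
`[E_n(ℚ) : φ_n(A_n(ℚ)) + E_n[2]]` is finite (positive index) and
`4 · [E_n(ℚ) : φ_n(A_n(ℚ)) + E_n[2]] ≤ #{even partitions of G(−n)} = #NS(L(G(−n)))`.
Printed chain: `2^{ρ(n)} = [E_n(ℚ) : φ_n(A_n(ℚ)) + E_n[2]]` (TYZ 2017 §1) `= #α(E_n(ℚ))/4 ≤ |S′_n|/4`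
(Silverman AEC X.4.9: `E_n(ℚ)/φ̂(E′_n(ℚ)) ↪ S^{(φ̂)}(E′_n/ℚ) = S′_n`, the classes `±1, ±n` coming from
`E_n[2]`) and `|S′_n| = #{(V₁, V₂) ⊢_e G(−n)}` (Faulkner–James Thm. 1.2 (2)) `= #NS(L(G(−n)))`
(Feng–Xiong Lemma 2.2). PROVED here directly on rational points: `α = x (mod ℚ^{×2})` has kernel in
`φ_n(A_n(ℚ))` (`some_mem_isogenyImageTYZ_of_sq`), and its sign/parity coordinates land in the null space
of `L(G(−n))` by the local conditions at the `pᵢ ≡ 1 (mod 4)` (type `I₀*`) and at `2` (`χ₈`); so no Selmer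
group and no Mordell–Weil theorem is needed. The hypothesis `0 < t` (`n > 1`, as in Faulkner–James, p. 1)
is necessary: for `n = 1` the index is `1` while the null space has `2` elements.
[cite: FaulknerJames2007, Thm. 1.2 (2) with Def. 1.5 and Lemma 5.1 (preprint p. 3 L57–L61, p. 13 L40–L49)]
[cite: SilvermanAEC2009, Prop. X.4.9] [cite: TianYuanZhang2017, §1, definition of ρ(n) (p0002 L101–L110)] -/
theorem rhoIndex_pos_and_four_mul_le_card_ker (ht : 0 < t) (hp : ∀ i, (p i).Prime)
    (hinj : Function.Injective p) (h8 : (∏ i, p i) % 8 = 1 ∨ (∏ i, p i) % 8 = 7) :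
    0 < (rhoSubgroup (∏ i, p i)).index ∧
      4 * (rhoSubgroup (∏ i, p i)).index ≤
        Fintype.card {x : Fin (t + 1) → ZMod 2 // fjLaplacianNeg p *ᵥ x = 0} := by
  classical
  set U : AddSubgroup (Fin (t + 1) → ZMod 2) := (torsionVecHom t).range with hU
  set R : AddSubgroup (Fin (t + 1) → ZMod 2) := (coordVec p hp).range with hR
  set C := U.comap (coordVec p hp) with hC
  have hUR : U ≤ R := range_torsionVecHom_le p hp hinj
  have hCle : C ≤ rhoSubgroup (∏ i, p i) := comap_le_rhoSubgroup p hp hinj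
  -- `#U · [R : U] = #R`, `[E : C] = [R : U]`
  have hCidx : C.index = U.relIndex R := AddSubgroup.index_comap _ _
  have hmul : Nat.card U * U.relIndex R = Nat.card R := by
    have := AddSubgroup.relIndex_mul_relIndex ⊥ U R bot_le hUR
    rwa [AddSubgroup.relIndex_bot_left, AddSubgroup.relIndex_bot_left] at this
  rw [natCard_range_torsionVecHom ht] at hmul
  -- `#R ≤ #NS(L)`
  have hRle : Nat.card R ≤ Fintype.card {x : Fin (t + 1) → ZMod 2 // fjLaplacianNeg p *ᵥ x = 0} := by
    rw [← Nat.card_eq_fintype_card]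
    have key : Nat.card ↥((R : Set (Fin (t + 1) → ZMod 2))) ≤
        Nat.card ↥({x : Fin (t + 1) → ZMod 2 | fjLaplacianNeg p *ᵥ x = 0} : Set (Fin (t + 1) → ZMod 2)) :=
      Nat.card_mono (Set.toFinite _) (by
        rintro _ ⟨P, rfl⟩
        exact fjLaplacianNeg_mulVec_coordVec p hp hinj h8 P)
    exact key
  -- `[E : rho] ∣ [E : C] = #R / 4 > 0`
  have hRpos : 0 < Nat.card R := Nat.card_pos
  have hCpos : 0 < C.index := by
    rw [hCidx]
    refine Nat.pos_of_ne_zero fun h0 => ?_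
    rw [h0, mul_zero] at hmul
    omega
  have hdvd : (rhoSubgroup (∏ i, p i)).index ∣ C.index := AddSubgroup.index_dvd_of_le hCle
  refine ⟨Nat.pos_of_dvd_of_pos hdvd hCpos, ?_⟩
  calc 4 * (rhoSubgroup (∏ i, p i)).index ≤ 4 * C.index :=
        Nat.mul_le_mul_left 4 (Nat.le_of_dvd hCpos hdvd)
    _ = Nat.card R := by rw [hCidx, hmul]
    _ ≤ _ := hRle

/-- **DOOR (the V1 certificate of `p2/monsky/RHO-CERT-NOTE.md` §E, now unconditional):** if the null space
of `L(G(−n))` has exactly `4` elements — only the trivial even partitions, i.e. `S′_n = {±1, ±n}`,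
`ŝ(n) = 0` — then `[E_n(ℚ) : φ_n(A_n(ℚ)) + E_n[2]] = 1`, i.e. Tian–Yuan–Zhang's `ρ(n) = 0`. The kernel
count is decided per `n` by `decide` (p2-monsky-eng's certificate generator), with `p` the tuple of the
primes of `n`. [cite: FaulknerJames2007, Thm. 1.2 (2)] [cite: TianYuanZhang2017, §1, definition of ρ(n)] -/
theorem rhoIndex_eq_one_of_card_ker (hp : ∀ i, (p i).Prime) (hinj : Function.Injective p)
    (h8 : (∏ i, p i) % 8 = 1 ∨ (∏ i, p i) % 8 = 7)
    (hcard : Fintype.card {x : Fin (t + 1) → ZMod 2 // fjLaplacianNeg p *ᵥ x = 0} = 4) {n : ℕ}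
    (hn : ∏ i, p i = n) : (rhoSubgroup n).index = 1 := by
  subst hn
  have ht : 0 < t := by
    rcases Nat.eq_zero_or_pos t with rfl | ht
    · -- `t = 0`: the ambient space `𝔽₂^1` has only `2` elements
      exfalso
      have hle : Fintype.card {x : Fin (0 + 1) → ZMod 2 // fjLaplacianNeg p *ᵥ x = 0} ≤
          Fintype.card (Fin (0 + 1) → ZMod 2) := Fintype.card_subtype_le _
      rw [hcard] at hle
      simp [ZMod.card] at hle
    · exact ht
  obtain ⟨h0, hle⟩ := rhoIndex_pos_and_four_mul_le_card_ker p ht hp hinj h8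
  rw [hcard] at hle
  omega

/-- **The prime family (T-54), certificate-free:** for EVERY prime `q ≡ ±1 (mod 8)`,
`[E_q(ℚ) : φ_q(A_q(ℚ)) + E_q[2]] = 1`, i.e. Tian–Yuan–Zhang's `ρ(q) = 0` — the case `t = 1` of the bound:
`4 · index ≤ #NS(L(G(−q))) ≤ #𝔽₂² = 4` (in fact `G(−q)` has no arcs, `S′_q = {±1, ±q}`; Faulkner–James
Thm. 1.2 (2) with `t + l = 1`). [cite: FaulknerJames2007, Thm. 1.2 (2)] [cite: TianYuanZhang2017, §1, definition of ρ(n)] -/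
theorem rhoIndex_eq_one_of_prime {q : ℕ} (hq : q.Prime) (h8 : q % 8 = 1 ∨ q % 8 = 7) :
    (rhoSubgroup q).index = 1 := by
  have hprod : (∏ i, (![q] : Fin 1 → ℕ) i) = q := by simp
  have h8' : (∏ i, (![q] : Fin 1 → ℕ) i) % 8 = 1 ∨ (∏ i, (![q] : Fin 1 → ℕ) i) % 8 = 7 := by rwa [hprod]
  obtain ⟨h0, hle⟩ := rhoIndex_pos_and_four_mul_le_card_ker ![q] Nat.one_pos (fun i => by fin_cases i; exact hq)
    (fun i j _ => Subsingleton.elim i j) h8'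
  rw [hprod] at h0 hle
  have h4 : 4 * (rhoSubgroup q).index ≤ 4 :=
    hle.trans ((Fintype.card_subtype_le _).trans (le_of_eq (by simp [ZMod.card])))
  omega

end Count

end Literature.NumberTheory.EllipticCurves.FaulknerJames2007

end
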